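import Literature.MathematicalPhysics.QuantumFieldTheory.Balaban1983to89.B11Eq174ChartLipschitzAtFlatW80LatticeFree
import Literature.MathematicalPhysics.QuantumFieldTheory.Balaban1983to89.B11Eq174ChartLipschitzAtFlatLatticeFreeClosed
import Literature.MathematicalPhysics.QuantumFieldTheory.Balaban1983to89.B11Eq117ChartLettersOnModel
import Literature.MathematicalPhysics.QuantumFieldTheory.Balaban1983to89.B11Ineq98W80TwoBackgroundLatticeFree
import Literature.MathematicalPhysics.QuantumFieldTheory.Balaban1983to89.B11Ineq98W80CompositeLatticeFree
import Literature.MathematicalPhysics.QuantumFieldTheory.Balaban1983to89.B11Eq118RegimeRadiiUniform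
import Literature.MathematicalPhysics.QuantumFieldTheory.Balaban1983to89.B11Eq118RegimeScalars
import Literature.MathematicalPhysics.QuantumFieldTheory.Balaban1983to89.B11Eq28JcurWindow
import Literature.MathematicalPhysics.QuantumFieldTheory.Balaban1983to89.B11Ineq88KernelLettersFlatChain

/-!
# `Balaban1983to89.B11Eq174ChartRegimesLipschitzAtFlatW80LatticeFree` — T. Bałaban, *The variational problem and background fields in renormalization group method for
# lattice gauge theories*, Commun. Math. Phys. **102** (1985) 277–309 [Balaban1985Variational] Prop. 6 (116)–(121) p. 295, (174)–(175) p. 305, Prop. 4 (97)–(98)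
# pp. 292–293, (44)–(47) p. 285; [Balaban1985BackgroundPropagators] Thm 3.4 p. 400, (3.122) p. 420, (3.153) p. 426; [Balaban1985Averaging] Proposition 7 p. 43:
# **ONE `k`-LEVEL CHART (174)∘(47) WITH THE GENUINE (L3) SLOT — ITS CONTRACTION REGIMES AT `U` AND AT THE VACUUM AND ITS LIPSCHITZ MODULUS AT THE FLAT POINT,
# LATTICE-FREE, ABOUT THE SAME RADII** — the sibling `B11Eq174ChartLipschitzAtFlatW80LatticeFree.exists_chartHB_W80_lipschitz_at_flat_latticeFree` (this lineage,
# gen 105) RE-RUN with its proof-interior data EXPORTED: per lattice `∃ C_G C₄ R′_w j_r a_r a_C` with `Regime 𝔊̃_k(U) 0 W80(U) C_G 0 C₄ R′_w j_r a_r ε₄`,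
# `Regime 𝔊_k(1) 0 W80(1) …`, `Regime H̃_{1,k}(U) 0 C_k(U) C_G 0 C2T ρ 0 a_C ε_C`, `Regime H_{1,k}(1) 0 C_k(1) …`, `ε₄ + a_r ≤ a_C`, `R′_w ≤ a_C`,
# `‖H̃_{1,k}(U)B‖, ‖H_{1,k}(1)B‖ < a_r` on `‖B‖ < R_b`, `(ε₄ + a_r)∕(1 − 4C_G·C2T·(ε_C + a_C)) ≤ R_map`, AND the Lipschitz member `‖ι(chart_U B) − chart_1 B‖ ≤ K·(j₀ + α)`
# — so that a consumer obtains (Ψ1)–(Ψ3) (`NE9B11ChartAnalytic.chartHB_triple_of_twoRegimes`, with `B11Eq80Current.analyticOnNhd_W80_lt` and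
# `B11Eq44CLetterTower.analyticOnNhd_Cck`) AND the background modulus FOR ONE AND THE SAME CHART (the existence faces and the Lipschitz faces landed so far quantify
# their radii separately).  NE9 crux-team LEAF PROVER 01 (`b2b-balaban-t4-ne9-formalise-leaf-01`), gen 106; cell `pub-balaban`∕`t4`, row NE9, bears_on R4/N22;
# composition BY NAME; [folklore].
WHAT IS PROVED (sorry-free; 0 `def`): **`exists_chartHB_W80_regimes_lipschitz_at_flat_latticeFree`** (statement = the sibling's with `R_map` added before `∀` and the
package above inserted before `∀ B`; proof = the sibling's, the regimes `R₁ R₂ RC₁ RC₂` and the fibre-map bounds it builds handed out instead of consumed only).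
HONEST SCOPE: composition BY NAME on the cell's MODEL rows (O-NE9-1; #5 UNRULED); constants crude and symbolic; `j₀`, `α` displayed separately; nothing of [B11] Prop. 4,
Prop. 6, (174)–(175), [B9] Thm 3.4 or [B7] Prop. 7 asserted as printed; «NE9 ⇐ the named binders»; NE9 NOT PRINTED ∕ NOT PROVED; spine PROVED 0∕9; rung (B)+1 finite
T⁴ — NOT infinite volume, NOT mass gap, NOT BetaPertH, NOT Clay.  HONEST DEPENDENCY: continuum YM on T⁴ ⇐ BetaPertH ∧ nine spine estimates (0/9 proved); BetaPertH ⇐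
(D1) ∧ (D4) ∧ CAP+tail; G-an2-4 gates asym, D1 and NE2/3/4.  NEW file; nothing modified.  Net new unproved facts: 0.
-/

noncomputable section

open Metric Set

namespace Literature.MathematicalPhysics.QuantumFieldTheory.Balaban1983to89.B11Eq174ChartRegimesLipschitzAtFlatW80LatticeFree

open scoped InnerProductSpace ComplexConjugate BigOperators
open B11Eq103H1Complex B11Eq115Space B11Eq174Chart
open B11Eq111FrakG (nabla115 jetLinearEquiv)
open B13Contraction113 (QuadAnalytic)
open B9SectCLatticeCarrier (Bond bpos btgt shift unshift)
open B4Sect5Torus (TSite)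
open B4Sect5Proof (latticeConst latticeConst_nonneg)
open B7Prop1Explicit (U1 Wcx boxVec)
open B7Prop2Explicit (pdev AvgClosed C0 c2')
open B7Prop3Flat (c3)
open B7Prop5GeneralLevels (thetaGen C3Gen)
open B7Prop5CplxLevels (epsCplx tauCplx C3Cplx)
open B9Eq315QTorus (perCfg cornerSite)
open B9Eq315QTower (towerP UlevOf)
open B9Eq315QTowerFlat (perCfg_UlevOf_one_mem_U1 norm_Wcx_UlevOf_one_sub_one_le UlevOf_one)
open B9Eq326OperatorTower (QkW laplaceAk RofUk)
open B9Eq310HessianOperator (adTransportW hessOp)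
open B9Eq310DeltaPrime (plaqHolU plaqHolU_one)
open B9Eq324DeltaPrimeATower (laplacePrimeAk)
open B9Eq3119DeltaPiTower (laplaceAkPi)
open B9Eq3119DeltaPiTowerFlat (laplaceAkPi_one_pos_iff laplaceAkPi_one_eq_laplaceAk_one)
open B9Eq3119DeltaPiCarrier (currentCLM)
open B11Eq118RegimeScalars (exists_regime_scalars)
open B11Eq118RegimeRadiiUniform (Regime.of_normBound_zeroLinear)
open B11Eq44COperatorTower (C2T C2T_nonneg)
open B11Eq44CLetterTower (Cck quadAnalytic_Cck)
open B11Eq80Current (W80)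
open B11Eq63V0GroupCurrent (curV0)
open B7Eq43AveragedSmallnessLevelFree (pdev_perCfg_le_of_plaq)
open B11Eq117ChartLettersOnModel (exists_norm_chartLetters_le)
open B11Eq174ChartLipschitzAtFlatLatticeFreeClosed (exists_chartHB_lipschitz_at_flat_latticeFree)
open B11Ineq88KernelLettersFlatChain (J_flat_le_zero H1LatticeCLM_laplaceAkPi_one)
open B9Eq3119DeltaPiTowerFlat (letters_laplaceAkPi_one)
open B11Eq44COperatorTowerTwoBackgrounds (sectC_modulus_tower)
open B11Ineq98W80TwoBackgroundLatticeFree (exists_W80_sub_flat_latticeFree)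
open B11Ineq98W80CompositeLatticeFree (exists_quadAnalytic_W80_composite_latticeFree)
open B11Eq174ChartLipschitzAtFlatW80LatticeFree (frakGLatticeCLM_laplaceAkPi_one)

variable {d : ℕ} (hd : 1 ≤ d) (L : ℕ) [NeZero L] (hL : 1 ≤ L) (hL2 : 2 ≤ L) (hL3 : 3 ≤ L) [Fact (0 < (L : ℝ))]
  {𝔸 : Type*} [NormedRing 𝔸] [NormedAlgebra ℂ 𝔸] [CompleteSpace 𝔸] [NormOneClass 𝔸] [StarRing 𝔸] [NormedStarGroup 𝔸] [StarModule ℂ 𝔸] [FiniteDimensional ℂ 𝔸]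
  {W : Type*} [NormedAddCommGroup W] [InnerProductSpace ℂ W] [FiniteDimensional ℂ W] (φ : W ≃ₗ[ℂ] 𝔸)
  {Mφ Mφ' : ℝ} (hMφ : 0 ≤ Mφ) (hMφ' : 0 ≤ Mφ') (hφ : ∀ w, ‖φ w‖ ≤ Mφ * ‖w‖) (hφ' : ∀ X, ‖φ.symm X‖ ≤ Mφ' * ‖X‖) (hstar : ∀ X : 𝔸, ‖star X‖ ≤ ‖X‖)
  {a : ℝ} (ha : 0 < a) {a' : ℝ} (ha' : 0 < a') {ϱ : ℝ} (hϱ0 : 0 ≤ ϱ) (hϱ1 : ϱ < 1)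
  (τ : 𝔸 →ₗ[ℂ] ℂ) {Cτ : ℝ} (hτ : ∀ X, ‖τ X‖ ≤ Cτ * ‖X‖) (hCτ : 0 ≤ Cτ) {Mτ : ℝ} (hτm : ∀ X Y : 𝔸, ‖τ (X * Y)‖ ≤ Mτ * ‖X‖ * ‖Y‖) (hMτ : 0 ≤ Mτ)
  {ρw : ℝ} (hρw : 0 ≤ ρw)
  (hτ₁ : ∀ X : 𝔸, τ (star X) = conj (τ X)) (hτ₂ : ∀ X Y : 𝔸, τ (X * Y) = τ (Y * X)) (hφτ : ∀ X Y : 𝔸, ⟪φ.symm X, φ.symm Y⟫_ℂ = τ (star X * Y))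
  (AQ : ℝ)
  {ι : Type} [Fintype ι] [DecidableEq ι] (b : Module.Basis ι ℝ 𝔸) {M₂ : ℝ} (hM₂ : 0 ≤ M₂) (hrepr : ∀ (v : 𝔸) (i : ι), |b.repr v i| ≤ M₂ * ‖v‖)
  {G : Subgroup 𝔸ˣ} (hG : AvgClosed d L G) {α₀ : ℝ} (hα₀ : 0 < α₀) (hα3 : C0 d * α₀ ≤ 1 / 3) (hα4 : 4 * α₀ ≤ c2' d L) (hα8 : 8 * α₀ ≤ c2' d L)
  {ρ : ℝ} (hρ0 : 0 < ρ) (hρ : Real.exp (4 * (800 * ((d : ℝ) + 1) ^ 2 * ((d : ℝ) + 4)) * α₀) * (1 + 8 * (131072 * ((d : ℝ) + 1) ^ 2) * ρ) ≤ 2)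
  (hρ4 : 4 * ρ ≤ c3 d L) (hθ : 2 * d * thetaGen d L α₀ ≤ (L : ℝ) ^ 3 / 16) (hC3 : 2 * d * C3Gen d L * ρ ≤ 1)
  {ω Ω : ℝ} (hω1 : 1 ≤ ω) (hΩ1 : 1 ≤ Ω)
  {r' : ℝ} (hr' : 0 < r')
  (h7s' : Real.exp (4 * (800 * ((d : ℝ) + 1) ^ 2 * ((d : ℝ) + 4)) * α₀) * (1 + 8 * (131072 * ((d : ℝ) + 1) ^ 2) * r') ≤ 2)
  (h7c' : 2 * r' ≤ c3 d L) (h7r'1 : 409600 * ((d : ℝ) + 1) ^ 2 * r' ≤ 1)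
  (h7s : Real.exp (4480 * ((d : ℝ) + 1) ^ 2 * ((d : ℝ) + 4) * α₀ + 240000 * ((d : ℝ) + 1) ^ 3 * r') * (1 + 8 * (2097152 * ((d : ℝ) + 1) ^ 2) * ρ) ≤ 2)
  (h7c : 16 * ρ < c3 d L) (h7β : (d : ℝ) * C3Cplx d L * ρ ≤ 1)
  -- the genuine slot's displayed scalar letters: the V₀-group's (98)-constant and radius, the fibre map's and the currents' bounds
  {CV RV Mρ MJ : ℝ} (hCV : 0 ≤ CV) (hRV : 0 < RV) (hRV' : RV ≤ 1 / 16) (hMρ : 0 ≤ Mρ) (hMJ : 0 ≤ MJ)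


/-! ## §2 The face with `δ_C` AND `δ_W` discharged -/

-- deep definitional unfolding `laplaceAkPi` ↦ `laplaceALatticeK … (π†Δπ) …` in the statement (as the host)
set_option maxRecDepth 8192 in
set_option maxHeartbeats 12800000 in
include hd hL hL2 hL3 hMφ hMφ' hφ hφ' hstar ha ha' hϱ0 hϱ1 hτ hCτ hτm hMτ hρw hτ₁ hτ₂ hφτ hM₂ hrepr hG hα₀ hα3 hα4 hα8 hρ0 hρ hρ4 hθ hC3 hω1 hΩ1 hr' h7s' h7c' h7r'1 h7s h7c h7β
  hCV hRV hRV' hMρ hMJ in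
/-- **ONE CHART: ITS REGIMES AT `U` AND AT THE VACUUM, AND ITS LIPSCHITZ MODULUS AT THE FLAT POINT, LATTICE-UNIFORMLY** — see the module header: with
`α₁ j₁ ε₄ ε_C R_b R_map K` BEFORE `∀`, for every lattice and background of the MODEL block: `∃ C_G C₄ R′_w j_r a_r a_C` with the two W-slot regimes (Prop. 6's
(117)–(121) for `chart_U[W80(U)]` and `chart_1[W80(1)]`), the two Sect. C regimes ((44)–(47) for `C_k(U)`, `C_k(1)`), the fibre-map bounds `‖H̃_{1,k}(U)B‖, ‖H_{1,k}(1)B‖ < a_r`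
on `‖B‖ < R_b`, the radii bookkeeping, and `‖ι(chart_U B) − chart_1 B‖ ≤ K·(j₀ + α)` — all about the SAME radii `(ε₄, ε_C)`. [folklore]
[cite: Balaban1985Variational, Prop. 4 (97)–(98) pp.292–293, Prop. 6 (116)–(121) p.295, (117) p.295, (174)–(175) p.305, (47) p.284; Balaban1985BackgroundPropagators, Thm 3.4 p.400, (3.122) p.420, (3.126) p.420, (3.153) p.426, Thm 3.13 p.426; Balaban1985Averaging, Proposition 7 p.43] -/
theorem exists_chartHB_W80_regimes_lipschitz_at_flat_latticeFree :
    ∃ α₁ j₁ ε₄ εC Rb Rmap K : ℝ, 0 < α₁ ∧ 0 < j₁ ∧ 0 < ε₄ ∧ 0 < εC ∧ 0 < Rb ∧ 0 < Rmap ∧ 0 < K ∧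
      ∀ (n : ℕ) (η : ℝ) [Fact (0 < η)] (_hηL : η * (L : ℝ) ^ (n + 1) = 1) (c₀ c₁ : ℝ) [Fact (0 < c₀)] [Fact (0 < c₁)]
        (_hw : c₀ * ((L : ℝ) ^ (n + 1)) ^ d = c₁) (_hρ : |η| ^ d / c₀ ≤ ρw) (m : Fin d → ℕ) [∀ i, NeZero (m i)] (_hm : ∀ i, 1 ≤ m i)
        (U : Bond d (towerP L m (n + 1)) → 𝔸ˣ) (αU : ℕ → ℝ) (_hα0 : ∀ j, 0 ≤ αU j) (hα1 : ∀ j, αU j ≤ 1 / 64)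
        (_hαL : ∀ j, 50 * (d + 1) * αU j * (L : ℝ) ^ d ≤ 1 / 2)
        (hU1 : ∀ (j : ℕ) (x : B7Prop1Explicit.Site d) (k : Fin d), perCfg (towerP L m (j + 1)) (UlevOf L m (n + 1) U j) x k ∈ U1 𝔸)
        (hreg : ∀ (j : ℕ) (y : TSite d (towerP L m j)) (k : Fin d) (ρ' : Fin d → Fin L),
          ‖((Wcx L (perCfg (towerP L m (j + 1)) (UlevOf L m (n + 1) U j)) (cornerSite L y) k (boxVec L ρ') : 𝔸ˣ) : 𝔸) - 1‖ ≤ αU j)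
        (εU : ℕ → ℝ) (_hεU : ∀ j, 0 ≤ εU j) (_hε1 : ∀ j, εU j ≤ 1) (_hUε : ∀ (j : ℕ) (b : Bond d (towerP L m (j + 1))), ‖(UlevOf L m (n + 1) U j b : 𝔸) - 1‖ ≤ εU j)
        (_hLb : ∀ (j : ℕ) (b : Bond d (towerP L m (j + 1))), UlevOf L m (n + 1) U j b ∈ U1 𝔸)
        (α : ℝ) (_hα : 0 ≤ α) (_hαle : α ≤ α₁)
        (hUst : ∀ b, star (U b : 𝔸) = (((U b)⁻¹ : 𝔸ˣ) : 𝔸)) (_hUb : ∀ b, U b ∈ U1 𝔸) (_hUη : ∀ b, ‖(U b : 𝔸) - 1‖ ≤ α * η)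
        (_hUw : ∀ (x : TSite d (towerP L m (n + 1))) (μ ν : Fin d), ‖(U (shift ν x, μ) : 𝔸) - (U (x, μ) : 𝔸)‖ ≤ α * η ^ 2)
        (_hpl : ∀ p : B9SectCLatticeCarrier.Plaq d (towerP L m (n + 1)), ‖(plaqHolU U p : 𝔸) - 1‖ ≤ α * η ^ 2)
        (_hUgrad : ∀ (x : TSite d (towerP L m (n + 1))) (μ : Fin d), ‖(U (x, μ) : 𝔸) - U (unshift μ x, μ)‖ ≤ α * η ^ 2)
        (_hRlev : ∀ (j : ℕ) (b : Bond d (towerP L m (j + 1))) (w : W), ‖adTransportW φ (UlevOf L m (n + 1) U j) b w‖ ≤ ‖w‖)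
        (_hεg : ∀ j < n + 1, εU j ≤ α * ϱ ^ j) (_hAQ : ∑ j ∈ Finset.range (n + 1), αU j ≤ AQ)
        (hpos' : ∀ x : SiteL2K ℂ d (towerP L m (n + 1)) c₀ W, x ≠ 0 → 0 < RCLike.re ⟪x, laplacePrimeAk L m n φ η U a' (c₁ := c₁) x⟫_ℂ)
        (hpos : ∀ x : BondL2K ℂ d (towerP L m (n + 1)) c₀ W, x ≠ 0 →
          0 < RCLike.re ⟪x, laplaceAk L m n φ η U hL αU hα1 hU1 hreg τ (c₀ := c₀) (c₁ := c₁) a x⟫_ℂ)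
        (_hc₀η : c₀ = η ^ d) (j₀ : ℝ) (_hJ : ∀ μ y, ‖B9Eq39Adjoint.J (fun μ => B9Eq33CovDerivVector.shiftEquiv μ) (fun μ y => U (y, μ)) η μ y‖ ≤ j₀) (_hj : j₀ ≤ j₁)
        (hposπ : ∀ x : BondL2K ℂ d (towerP L m (n + 1)) c₀ W, x ≠ 0 →
          0 < RCLike.re ⟪x, laplaceAkPi L m n φ τ η U a' hpos' hL αU hα1 hU1 hreg (c₁ := c₁) a x⟫_ℂ)
        (hQ : Function.Surjective (QkW L m n φ U hL αU hα1 hU1 hreg (c₀ := c₀) (c₁ := c₁)))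
        (hpos'₁ : ∀ x : SiteL2K ℂ d (towerP L m (n + 1)) c₀ W, x ≠ 0 →
          0 < RCLike.re ⟪x, laplacePrimeAk L m n φ η (fun _ : Bond d (towerP L m (n + 1)) => (1 : 𝔸ˣ)) a' (c₁ := c₁) x⟫_ℂ)
        (hpos₁ : ∀ x : BondL2K ℂ d (towerP L m (n + 1)) c₀ W, x ≠ 0 →
          0 < RCLike.re ⟪x, laplaceAk L m n φ η (fun _ : Bond d (towerP L m (n + 1)) => (1 : 𝔸ˣ)) hL (fun _ => 0) (fun _ => by norm_num)
            (perCfg_UlevOf_one_mem_U1 L m (n + 1)) (norm_Wcx_UlevOf_one_sub_one_le L m (n + 1) (fun _ => 0) (fun _ => le_rfl)) τ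
            (c₀ := c₀) (c₁ := c₁) a x⟫_ℂ)
        (hQ1 : Function.Surjective (QkW L m n φ (fun _ : Bond d (towerP L m (n + 1)) => (1 : 𝔸ˣ)) hL (fun _ => 0) (fun _ => by norm_num)
          (perCfg_UlevOf_one_mem_U1 L m (n + 1)) (norm_Wcx_UlevOf_one_sub_one_le L m (n + 1) (fun _ => 0) (fun _ => le_rfl)) (c₀ := c₀) (c₁ := c₁)))
        (_hUG : ∀ (x : B7Prop1Explicit.Site d) (κ : Fin d), perCfg (towerP L m (n + 1)) U x κ ∈ G)
        (lev₀ : Bond d (towerP L m (n + 1)) → ℕ) (levB : Bond d m → ℕ) (lev₁ : Bond d (towerP L m (n + 1)) × Fin d → ℕ) (_hlev : ∀ b, n + 1 ≤ lev₀ b)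
        (_hw₀ : (NegSup.wSup (levWeight (L : ℝ) η lev₀ 1) : ℝ) ≤ ω) (_hw₁ : (NegSup.wSup (levWeight (L : ℝ) η lev₁ 2) : ℝ) ≤ ω)
        (_hw₁' : (NegSup.wInvSup (levWeight (L : ℝ) η lev₀ 1) : ℝ) ≤ Ω)
        (_hw₃ : (NegSup.wInvSup (levWeight (L : ℝ) η lev₀ 3) : ℝ) ≤ Ω) (_hwB : (NegSup.wInvSup (levWeight (L : ℝ) η levB 0) : ℝ) ≤ Ω)
        (_hw₁₂ : (NegSup.wInvSup (levWeight (L : ℝ) η lev₁ 2) : ℝ) ≤ Ω)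
        (_h7E : epsCplx d L (r' / (L : ℝ) ^ (n + 1)) (n + 1) ≤ 1 / 16)
        (_h7dX : (d : ℝ) * (epsCplx d L (r' / (L : ℝ) ^ (n + 1)) (n + 1) + tauCplx d L α₀ (n + 1) (r' / (L : ℝ) ^ (n + 1)) (n + 1)) ≤ 1 / 16)
        -- the genuine (L3) slot's letters: unitary level backgrounds, the fibre map, the two currents (window `j₀`), the V₀-group's (98)-bound at `U` and at `1`
        (_hUlev : ∀ (j : ℕ) (bb : Bond d (towerP L m (j + 1))), star (UlevOf L m (n + 1) U j bb : 𝔸) = ((UlevOf L m (n + 1) U j bb)⁻¹ : 𝔸ˣ))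
        (ρV : (𝔸 →L[ℂ] ℂ) →L[ℂ] 𝔸) (_hρn : ‖ρV‖ ≤ Mρ) (J₁ J₂ : NegSize (L : ℝ) η lev₀ 3 𝔸) (_hJ₁ : ‖J₁‖ ≤ MJ * j₀) (_hJ₂ : ‖J₂‖ ≤ MJ * j₀)
        (_hqV : ∀ Y : Space115 (L : ℝ) η lev₀ lev₁ (nabla115 η U), ‖Y‖ < RV →
          ‖curV0 (lev₁ := lev₁) (Dc := nabla115 η U) ρV (LinearMap.toContinuousLinearMap τ) U Y‖ ≤ CV * ‖Y‖ ^ 2)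
        (_hqV₁ : ∀ Y : Space115 (L : ℝ) η lev₀ lev₁ (nabla115 η (fun _ : Bond d (towerP L m (n + 1)) => (1 : 𝔸ˣ))), ‖Y‖ < RV →
          ‖curV0 (lev₁ := lev₁) (Dc := nabla115 η (fun _ : Bond d (towerP L m (n + 1)) => (1 : 𝔸ˣ))) ρV (LinearMap.toContinuousLinearMap τ) (fun _ : Bond d (towerP L m (n + 1)) => (1 : 𝔸ˣ)) Y‖ ≤ CV * ‖Y‖ ^ 2),
      ∃ CG C₄ R'w jr ar aC : ℝ, 0 ≤ jr ∧ 0 < ar ∧ ε₄ + ar ≤ aC ∧ R'w ≤ aC ∧ 1 / (1 - 4 * CG * C2T d α₀ * (εC + aC)) * (ε₄ + ar) ≤ Rmap ∧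
        Regime (frakGLatticeCLM (L := (L : ℝ)) (η := η) (lev₀ := lev₀) φ hposπ hQ lev₁ (nabla115 η U)) 0
          (W80 ρV (LinearMap.toContinuousLinearMap τ) U (H1LatticeCLM (L := (L : ℝ)) (η := η) (lev₀ := lev₀) (levB := levB) φ hposπ hQ lev₁ (nabla115 η U))
                        (Cck L m η (n + 1) U lev₀ lev₁ (nabla115 η U) levB) εC J₁
                        (currentCLM φ lev₁ (nabla115 η U)
                          (laplaceAkPi L m n φ τ η U a' hpos' hL αU hα1 hU1 hreg (c₁ := c₁) a
                            - LinearMap.adjoint (QkW L m n φ U hL αU hα1 hU1 hreg (c₀ := c₀) (c₁ := c₁)) ∘ₗ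
                                ((a : ℂ) • QkW L m n φ U hL αU hα1 hU1 hreg (c₀ := c₀) (c₁ := c₁))))) CG 0 C₄ R'w jr ar ε₄ ∧
        Regime (frakGLatticeCLM (L := (L : ℝ)) (η := η) (lev₀ := lev₀) (c := ((η : ℂ))⁻¹)
              (R := adTransportW φ (fun _ : Bond d (towerP L m (n + 1)) => (1 : 𝔸ˣ)))
              (S := adTransportW φ fun _ : Bond d (towerP L m (n + 1)) => (1 : 𝔸ˣ)⁻¹) (Δ₁ := hessOp φ η (fun _ : Bond d (towerP L m (n + 1)) => (1 : 𝔸ˣ)) τ)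
              (Rr := RofUk L m n φ η (fun _ : Bond d (towerP L m (n + 1)) => (1 : 𝔸ˣ)))
              (Q := (QkW L m n φ (fun _ : Bond d (towerP L m (n + 1)) => (1 : 𝔸ˣ)) hL (fun _ => 0) (fun _ => by norm_num)
                (perCfg_UlevOf_one_mem_U1 L m (n + 1)) (norm_Wcx_UlevOf_one_sub_one_le L m (n + 1) (fun _ => 0) (fun _ => le_rfl)) (c₀ := c₀) (c₁ := c₁))) (a := a)
              φ hpos₁ hQ1 lev₁ (nabla115 η (fun _ : Bond d (towerP L m (n + 1)) => (1 : 𝔸ˣ)))) 0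
          (W80 ρV (LinearMap.toContinuousLinearMap τ) (fun _ : Bond d (towerP L m (n + 1)) => (1 : 𝔸ˣ))
                        (H1LatticeCLM (L := (L : ℝ)) (η := η) (lev₀ := lev₀) (levB := levB) (c := ((η : ℂ))⁻¹)
                        (R := adTransportW φ (fun _ : Bond d (towerP L m (n + 1)) => (1 : 𝔸ˣ)))
                        (S := adTransportW φ fun _ : Bond d (towerP L m (n + 1)) => (1 : 𝔸ˣ)⁻¹) (Δ₁ := hessOp φ η (fun _ : Bond d (towerP L m (n + 1)) => (1 : 𝔸ˣ)) τ)
                        (Rr := RofUk L m n φ η (fun _ : Bond d (towerP L m (n + 1)) => (1 : 𝔸ˣ)))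
                        (Q := (QkW L m n φ (fun _ : Bond d (towerP L m (n + 1)) => (1 : 𝔸ˣ)) hL (fun _ => 0) (fun _ => by norm_num)
                          (perCfg_UlevOf_one_mem_U1 L m (n + 1)) (norm_Wcx_UlevOf_one_sub_one_le L m (n + 1) (fun _ => 0) (fun _ => le_rfl)) (c₀ := c₀) (c₁ := c₁))) (a := a)
                        φ hpos₁ hQ1 lev₁ (nabla115 η (fun _ : Bond d (towerP L m (n + 1)) => (1 : 𝔸ˣ))))
                        (Cck L m η (n + 1) (fun _ : Bond d (towerP L m (n + 1)) => (1 : 𝔸ˣ)) lev₀ lev₁ (nabla115 η (fun _ : Bond d (towerP L m (n + 1)) => (1 : 𝔸ˣ))) levB) εC J₂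
                        (currentCLM φ lev₁ (nabla115 η (fun _ : Bond d (towerP L m (n + 1)) => (1 : 𝔸ˣ)))
                          (laplaceAk L m n φ η (fun _ : Bond d (towerP L m (n + 1)) => (1 : 𝔸ˣ)) hL (fun _ => 0) (fun _ => by norm_num)
                              (perCfg_UlevOf_one_mem_U1 L m (n + 1)) (norm_Wcx_UlevOf_one_sub_one_le L m (n + 1) (fun _ => 0) (fun _ => le_rfl)) τ (c₀ := c₀) (c₁ := c₁) a
                            - LinearMap.adjoint (QkW L m n φ (fun _ : Bond d (towerP L m (n + 1)) => (1 : 𝔸ˣ)) hL (fun _ => 0) (fun _ => by norm_num)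
                                (perCfg_UlevOf_one_mem_U1 L m (n + 1)) (norm_Wcx_UlevOf_one_sub_one_le L m (n + 1) (fun _ => 0) (fun _ => le_rfl)) (c₀ := c₀) (c₁ := c₁)) ∘ₗ
                                ((a : ℂ) • (QkW L m n φ (fun _ : Bond d (towerP L m (n + 1)) => (1 : 𝔸ˣ)) hL (fun _ => 0) (fun _ => by norm_num)
                                  (perCfg_UlevOf_one_mem_U1 L m (n + 1)) (norm_Wcx_UlevOf_one_sub_one_le L m (n + 1) (fun _ => 0) (fun _ => le_rfl)) (c₀ := c₀) (c₁ := c₁)))))) CG 0 C₄ R'w jr ar ε₄ ∧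
        Regime (H1LatticeCLM (L := (L : ℝ)) (η := η) (lev₀ := lev₀) (levB := levB) φ hposπ hQ lev₁ (nabla115 η U)) 0 (Cck L m η (n + 1) U lev₀ lev₁ (nabla115 η U) levB) CG 0 (C2T d α₀) ρ 0 aC εC ∧
        Regime (H1LatticeCLM (L := (L : ℝ)) (η := η) (lev₀ := lev₀) (levB := levB) (c := ((η : ℂ))⁻¹)
              (R := adTransportW φ (fun _ : Bond d (towerP L m (n + 1)) => (1 : 𝔸ˣ)))
              (S := adTransportW φ fun _ : Bond d (towerP L m (n + 1)) => (1 : 𝔸ˣ)⁻¹) (Δ₁ := hessOp φ η (fun _ : Bond d (towerP L m (n + 1)) => (1 : 𝔸ˣ)) τ)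
              (Rr := RofUk L m n φ η (fun _ : Bond d (towerP L m (n + 1)) => (1 : 𝔸ˣ)))
              (Q := (QkW L m n φ (fun _ : Bond d (towerP L m (n + 1)) => (1 : 𝔸ˣ)) hL (fun _ => 0) (fun _ => by norm_num)
                (perCfg_UlevOf_one_mem_U1 L m (n + 1)) (norm_Wcx_UlevOf_one_sub_one_le L m (n + 1) (fun _ => 0) (fun _ => le_rfl)) (c₀ := c₀) (c₁ := c₁))) (a := a)
              φ hpos₁ hQ1 lev₁ (nabla115 η (fun _ : Bond d (towerP L m (n + 1)) => (1 : 𝔸ˣ)))) 0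
          (Cck L m η (n + 1) (fun _ : Bond d (towerP L m (n + 1)) => (1 : 𝔸ˣ)) lev₀ lev₁ (nabla115 η (fun _ : Bond d (towerP L m (n + 1)) => (1 : 𝔸ˣ))) levB) CG 0 (C2T d α₀) ρ 0 aC εC ∧
        (∀ B ∈ ball (0 : NegSize (L : ℝ) η levB 0 𝔸) Rb, ‖(H1LatticeCLM (L := (L : ℝ)) (η := η) (lev₀ := lev₀) (levB := levB) φ hposπ hQ lev₁ (nabla115 η U)) B‖ < ar) ∧
        (∀ B ∈ ball (0 : NegSize (L : ℝ) η levB 0 𝔸) Rb, ‖(H1LatticeCLM (L := (L : ℝ)) (η := η) (lev₀ := lev₀) (levB := levB) (c := ((η : ℂ))⁻¹)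
              (R := adTransportW φ (fun _ : Bond d (towerP L m (n + 1)) => (1 : 𝔸ˣ)))
              (S := adTransportW φ fun _ : Bond d (towerP L m (n + 1)) => (1 : 𝔸ˣ)⁻¹) (Δ₁ := hessOp φ η (fun _ : Bond d (towerP L m (n + 1)) => (1 : 𝔸ˣ)) τ)
              (Rr := RofUk L m n φ η (fun _ : Bond d (towerP L m (n + 1)) => (1 : 𝔸ˣ)))
              (Q := (QkW L m n φ (fun _ : Bond d (towerP L m (n + 1)) => (1 : 𝔸ˣ)) hL (fun _ => 0) (fun _ => by norm_num)
                (perCfg_UlevOf_one_mem_U1 L m (n + 1)) (norm_Wcx_UlevOf_one_sub_one_le L m (n + 1) (fun _ => 0) (fun _ => le_rfl)) (c₀ := c₀) (c₁ := c₁))) (a := a)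
              φ hpos₁ hQ1 lev₁ (nabla115 η (fun _ : Bond d (towerP L m (n + 1)) => (1 : 𝔸ˣ)))) B‖ < ar) ∧
        ∀ (B : NegSize (L : ℝ) η levB 0 𝔸), ‖B‖ < Rb →
        ‖LinearMap.toContinuousLinearMap
              ((jetLinearEquiv (L : ℝ) η lev₀ lev₁ (nabla115 η (fun _ : Bond d (towerP L m (n + 1)) => (1 : 𝔸ˣ)))).symm.toLinearMap ∘ₗ
                (jetLinearEquiv (L : ℝ) η lev₀ lev₁ (nabla115 η U)).toLinearMap)
            (chartHB (frakGLatticeCLM (L := (L : ℝ)) (η := η) (lev₀ := lev₀) φ hposπ hQ lev₁ (nabla115 η U)) 0 (W80 ρV (LinearMap.toContinuousLinearMap τ) U (H1LatticeCLM (L := (L : ℝ)) (η := η) (lev₀ := lev₀) (levB := levB) φ hposπ hQ lev₁ (nabla115 η U))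
              (Cck L m η (n + 1) U lev₀ lev₁ (nabla115 η U) levB) εC J₁
              (currentCLM φ lev₁ (nabla115 η U)
                (laplaceAkPi L m n φ τ η U a' hpos' hL αU hα1 hU1 hreg (c₁ := c₁) a
                  - LinearMap.adjoint (QkW L m n φ U hL αU hα1 hU1 hreg (c₀ := c₀) (c₁ := c₁)) ∘ₗ
                      ((a : ℂ) • QkW L m n φ U hL αU hα1 hU1 hreg (c₀ := c₀) (c₁ := c₁))))) 0
              (fun A' => A' + solA (H1LatticeCLM (L := (L : ℝ)) (η := η) (lev₀ := lev₀) (levB := levB) φ hposπ hQ lev₁ (nabla115 η U)) 0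
                (Cck L m η (n + 1) U lev₀ lev₁ (nabla115 η U) levB) 0 εC A') ε₄
              (H1LatticeCLM (L := (L : ℝ)) (η := η) (lev₀ := lev₀) (levB := levB) φ hposπ hQ lev₁ (nabla115 η U)) B) -
          chartHB (frakGLatticeCLM (L := (L : ℝ)) (η := η) (lev₀ := lev₀) (c := ((η : ℂ))⁻¹)
              (R := adTransportW φ (fun _ : Bond d (towerP L m (n + 1)) => (1 : 𝔸ˣ)))
              (S := adTransportW φ fun _ : Bond d (towerP L m (n + 1)) => (1 : 𝔸ˣ)⁻¹) (Δ₁ := hessOp φ η (fun _ : Bond d (towerP L m (n + 1)) => (1 : 𝔸ˣ)) τ)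
              (Rr := RofUk L m n φ η (fun _ : Bond d (towerP L m (n + 1)) => (1 : 𝔸ˣ)))
              (Q := (QkW L m n φ (fun _ : Bond d (towerP L m (n + 1)) => (1 : 𝔸ˣ)) hL (fun _ => 0) (fun _ => by norm_num)
                (perCfg_UlevOf_one_mem_U1 L m (n + 1)) (norm_Wcx_UlevOf_one_sub_one_le L m (n + 1) (fun _ => 0) (fun _ => le_rfl)) (c₀ := c₀) (c₁ := c₁))) (a := a)
              φ hpos₁ hQ1 lev₁ (nabla115 η (fun _ : Bond d (towerP L m (n + 1)) => (1 : 𝔸ˣ)))) 0 (W80 ρV (LinearMap.toContinuousLinearMap τ) (fun _ : Bond d (towerP L m (n + 1)) => (1 : 𝔸ˣ))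
              (H1LatticeCLM (L := (L : ℝ)) (η := η) (lev₀ := lev₀) (levB := levB) (c := ((η : ℂ))⁻¹)
              (R := adTransportW φ (fun _ : Bond d (towerP L m (n + 1)) => (1 : 𝔸ˣ)))
              (S := adTransportW φ fun _ : Bond d (towerP L m (n + 1)) => (1 : 𝔸ˣ)⁻¹) (Δ₁ := hessOp φ η (fun _ : Bond d (towerP L m (n + 1)) => (1 : 𝔸ˣ)) τ)
              (Rr := RofUk L m n φ η (fun _ : Bond d (towerP L m (n + 1)) => (1 : 𝔸ˣ)))
              (Q := (QkW L m n φ (fun _ : Bond d (towerP L m (n + 1)) => (1 : 𝔸ˣ)) hL (fun _ => 0) (fun _ => by norm_num)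
                (perCfg_UlevOf_one_mem_U1 L m (n + 1)) (norm_Wcx_UlevOf_one_sub_one_le L m (n + 1) (fun _ => 0) (fun _ => le_rfl)) (c₀ := c₀) (c₁ := c₁))) (a := a)
              φ hpos₁ hQ1 lev₁ (nabla115 η (fun _ : Bond d (towerP L m (n + 1)) => (1 : 𝔸ˣ))))
              (Cck L m η (n + 1) (fun _ : Bond d (towerP L m (n + 1)) => (1 : 𝔸ˣ)) lev₀ lev₁ (nabla115 η (fun _ : Bond d (towerP L m (n + 1)) => (1 : 𝔸ˣ))) levB) εC J₂
              (currentCLM φ lev₁ (nabla115 η (fun _ : Bond d (towerP L m (n + 1)) => (1 : 𝔸ˣ)))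
                (laplaceAk L m n φ η (fun _ : Bond d (towerP L m (n + 1)) => (1 : 𝔸ˣ)) hL (fun _ => 0) (fun _ => by norm_num)
                    (perCfg_UlevOf_one_mem_U1 L m (n + 1)) (norm_Wcx_UlevOf_one_sub_one_le L m (n + 1) (fun _ => 0) (fun _ => le_rfl)) τ (c₀ := c₀) (c₁ := c₁) a
                  - LinearMap.adjoint (QkW L m n φ (fun _ : Bond d (towerP L m (n + 1)) => (1 : 𝔸ˣ)) hL (fun _ => 0) (fun _ => by norm_num)
                      (perCfg_UlevOf_one_mem_U1 L m (n + 1)) (norm_Wcx_UlevOf_one_sub_one_le L m (n + 1) (fun _ => 0) (fun _ => le_rfl)) (c₀ := c₀) (c₁ := c₁)) ∘ₗ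
                      ((a : ℂ) • (QkW L m n φ (fun _ : Bond d (towerP L m (n + 1)) => (1 : 𝔸ˣ)) hL (fun _ => 0) (fun _ => by norm_num)
                        (perCfg_UlevOf_one_mem_U1 L m (n + 1)) (norm_Wcx_UlevOf_one_sub_one_le L m (n + 1) (fun _ => 0) (fun _ => le_rfl)) (c₀ := c₀) (c₁ := c₁)))))) 0
            (fun A' => A' + solA (H1LatticeCLM (L := (L : ℝ)) (η := η) (lev₀ := lev₀) (levB := levB) (c := ((η : ℂ))⁻¹)
              (R := adTransportW φ (fun _ : Bond d (towerP L m (n + 1)) => (1 : 𝔸ˣ)))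
              (S := adTransportW φ fun _ : Bond d (towerP L m (n + 1)) => (1 : 𝔸ˣ)⁻¹) (Δ₁ := hessOp φ η (fun _ : Bond d (towerP L m (n + 1)) => (1 : 𝔸ˣ)) τ)
              (Rr := RofUk L m n φ η (fun _ : Bond d (towerP L m (n + 1)) => (1 : 𝔸ˣ)))
              (Q := (QkW L m n φ (fun _ : Bond d (towerP L m (n + 1)) => (1 : 𝔸ˣ)) hL (fun _ => 0) (fun _ => by norm_num)
                (perCfg_UlevOf_one_mem_U1 L m (n + 1)) (norm_Wcx_UlevOf_one_sub_one_le L m (n + 1) (fun _ => 0) (fun _ => le_rfl)) (c₀ := c₀) (c₁ := c₁))) (a := a)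
              φ hpos₁ hQ1 lev₁ (nabla115 η (fun _ : Bond d (towerP L m (n + 1)) => (1 : 𝔸ˣ)))) 0
              (Cck L m η (n + 1) (fun _ : Bond d (towerP L m (n + 1)) => (1 : 𝔸ˣ)) lev₀ lev₁ (nabla115 η (fun _ : Bond d (towerP L m (n + 1)) => (1 : 𝔸ˣ))) levB) 0 εC A') ε₄
            (H1LatticeCLM (L := (L : ℝ)) (η := η) (lev₀ := lev₀) (levB := levB) (c := ((η : ℂ))⁻¹)
              (R := adTransportW φ (fun _ : Bond d (towerP L m (n + 1)) => (1 : 𝔸ˣ)))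
              (S := adTransportW φ fun _ : Bond d (towerP L m (n + 1)) => (1 : 𝔸ˣ)⁻¹) (Δ₁ := hessOp φ η (fun _ : Bond d (towerP L m (n + 1)) => (1 : 𝔸ˣ)) τ)
              (Rr := RofUk L m n φ η (fun _ : Bond d (towerP L m (n + 1)) => (1 : 𝔸ˣ)))
              (Q := (QkW L m n φ (fun _ : Bond d (towerP L m (n + 1)) => (1 : 𝔸ˣ)) hL (fun _ => 0) (fun _ => by norm_num)
                (perCfg_UlevOf_one_mem_U1 L m (n + 1)) (norm_Wcx_UlevOf_one_sub_one_le L m (n + 1) (fun _ => 0) (fun _ => le_rfl)) (c₀ := c₀) (c₁ := c₁))) (a := a)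
              φ hpos₁ hQ1 lev₁ (nabla115 η (fun _ : Bond d (towerP L m (n + 1)) => (1 : 𝔸ˣ)))) B‖ ≤
          K * (j₀ + α) := by
  classical
  have hω : 0 ≤ ω := zero_le_one.trans hω1
  have hΩ : 0 ≤ Ω := zero_le_one.trans hΩ1
  have hC2T := C2T_nonneg d α₀
  have hC30 : 0 ≤ C3Gen d L := by unfold C3Gen B7Prop5GeneralLevels.C1ppGen; positivity
  -- (0) the suppliers, `∃`-first: the chart-level Lipschitz letters (ROUTE (J′)), the two operator norms, the W-slot's Prop. 4 lattice-free, the W-slot's modulus lattice-free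
  obtain ⟨αL, jL, KA, KG, KD, hαL0, hjL, hKA, hKG, hKD, HLip⟩ :=
    exists_chartHB_lipschitz_at_flat_latticeFree hd L hL hL3 φ hMφ hMφ' hφ hφ' hstar ha ha' hϱ0 hϱ1 τ hτ hCτ hτm hMτ hρw hτ₁ hτ₂ hφτ AQ b hM₂ hrepr
  obtain ⟨αN, jN, BN, hαN, hjN, hBN, HN⟩ :=
    exists_norm_chartLetters_le hd L hL hL3 φ hMφ hMφ' hφ hφ' hstar ha ha' hϱ0 hϱ1 τ hτ hCτ hτm hMτ hρw hτ₁ hτ₂ hφτ AQ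
  obtain ⟨αW, jW, BW, δW, B₁W, δ₁W, hαW, hjW, hBW, hδW, hB₁W, hδ₁W, HW⟩ :=
    exists_quadAnalytic_W80_composite_latticeFree hd L hL hL3 φ hMφ hMφ' hφ hφ' hstar ha ha' hϱ0 hϱ1 τ hτ hCτ hτm hMτ hρw hτ₁ hτ₂ hφτ AQ
  obtain ⟨CG, hCGd⟩ : ∃ C : ℝ, C = ω * (Mφ * BN * Mφ') * Ω := ⟨_, rfl⟩
  have hCG : 0 ≤ CG := by rw [hCGd]; positivity
  obtain ⟨αF, jF, BF, δF, hαF, hjF, hBF, hδF, HF12⟩ :=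
    exists_W80_sub_flat_latticeFree hd L hL hL2 hL3 φ hMφ hMφ' hφ hφ' hstar ha ha' hϱ0 hϱ1 τ hτ hCτ hτm hMτ hρw hτ₁ hτ₂ hφτ AQ b hM₂ hrepr hG hα₀ hα3 hα8 hρ0 hρ hρ4
      hθ hC3 hr' h7s' h7c' h7r'1 h7s h7c h7β (ϖ := ω ^ 3 * Ω) (ϖ' := ω ^ 3) (ω := ω) (Ω := Ω) (ω₃ := ω ^ 3) (ΩB := Ω) (CV := CV) (RV := RV) (Mρ := Mρ) (MJ := MJ)
      (bH := CG) (by positivity) (by positivity) hω1 hΩ1 (by positivity) hΩ hCV hRV hRV' hMρ hMJ hCG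
  obtain ⟨jfin, hjfin⟩ : ∃ j : ℝ, j = min (min jL jN) (min jW jF) := ⟨_, rfl⟩
  have hjfin0 : 0 < jfin := by rw [hjfin]; exact lt_min (lt_min hjL hjN) (lt_min hjW hjF)
  -- the lattice-free window letters of the two kernel routes (`Θ_W` of the W-slot's Prop. 4, `Θ_F` of the modulus) and `Γ`
  obtain ⟨ΘW, hΘW⟩ : ∃ c : ℝ, c = Mφ * BW * Mφ' * (d * latticeConst d δW) := ⟨_, rfl⟩
  obtain ⟨ΘF, hΘF⟩ : ∃ c : ℝ, c = Mφ * BF * Mφ' * (d * latticeConst d δF) := ⟨_, rfl⟩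
  obtain ⟨Γ, hΓd⟩ : ∃ c : ℝ, c = C3Gen d L * (2 ^ d * (2 * d)) := ⟨_, rfl⟩
  have hKδW : 0 ≤ latticeConst d δW := latticeConst_nonneg d hδW.le
  have hKδ₁W : 0 ≤ latticeConst d δ₁W := latticeConst_nonneg d hδ₁W.le
  have hKδF : 0 ≤ latticeConst d δF := latticeConst_nonneg d hδF.le
  obtain ⟨hΘW0, hΘF0, hΓ0⟩ : 0 ≤ ΘW ∧ 0 ≤ ΘF ∧ 0 ≤ Γ := ⟨by rw [hΘW]; positivity, by rw [hΘF]; positivity, by rw [hΓd]; positivity⟩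
  -- STAGE 1: the Sect. C radii `(a_C, ε_C)` below the cap collecting every smallness of the assembly
  have hcap0 : 0 < min (min (ρ / 6) (RV / 5)) (min (1 / (12 * CG * C2T d α₀ + 1)) (min (1 / (2 * (ΘF * Γ + 1))) (1 / (2 * (ΘW * Γ + 1))))) :=
    lt_min (lt_min (by positivity) (by positivity)) (lt_min (by positivity) (lt_min (by positivity) (by positivity)))
  obtain ⟨jT, aC, εC, hjT, haC, hεC, hcapT, hCdom, hCself, hCcontr⟩ :=
    exists_regime_scalars (B₀ := CG) (C₄ := C2T d α₀) (a₃ := ρ) hCG hC2T hρ0 hcap0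
  have hs0 : 0 < εC + aC := by linarith only [haC, hεC]
  have hCdom6 : 6 * (εC + aC) ≤ ρ := by linarith only [hcapT.trans ((min_le_left _ _).trans (min_le_left _ _))]
  have hεV : 4 * (εC + aC) < RV := by linarith only [hcapT.trans ((min_le_left _ _).trans (min_le_right _ _)), hRV]
  have hCcontr12 : 12 * CG * C2T d α₀ * (εC + aC) < 1 := by
    have h1 : εC + aC ≤ 1 / (12 * CG * C2T d α₀ + 1) := hcapT.trans ((min_le_right _ _).trans (min_le_left _ _))
    have h2 : (εC + aC) * (12 * CG * C2T d α₀ + 1) ≤ 1 := by rwa [← le_div_iff₀ (by positivity)]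
    nlinarith only [h2, hs0, mul_nonneg hCG hC2T]
  have hwin : ∀ {Θ : ℝ}, 0 ≤ Θ → εC + aC ≤ 1 / (2 * (Θ * Γ + 1)) → (εC + aC) * Θ * Γ ≤ 1 / 2 := by
    intro Θ hΘ h1
    have h2 : (εC + aC) * (2 * (Θ * Γ + 1)) ≤ 1 := by rwa [← le_div_iff₀ (by positivity)]
    nlinarith only [h2, hs0, mul_nonneg hΘ hΓ0]
  have hqF := hwin hΘF0 (hcapT.trans ((min_le_right _ _).trans ((min_le_right _ _).trans (min_le_left _ _))))
  have hqW := hwin hΘW0 (hcapT.trans ((min_le_right _ _).trans ((min_le_right _ _).trans (min_le_right _ _))))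
  rw [hΘF, hΓd] at hqF
  rw [hΘW, hΓd] at hqW
  have h1q : 0 < 1 - 4 * CG * C2T d α₀ * (εC + aC) := by linarith only [hCcontr]
  -- STAGE 2: the W-slot's `(C₄ᶜ, R′)` at these radii (lattice-free), then the chart radii `(jr, ar, ε₄)` below the cap `min (a_C/2) (R′/6) (1/(12·CG·C₄ᶜ+1))`
  obtain ⟨R', hR'd⟩ : ∃ R : ℝ, R = min aC ((1 - 4 * CG * C2T d α₀ * (εC + aC)) * RV) := ⟨_, rfl⟩
  have hR'0 : 0 < R' := by rw [hR'd]; exact lt_min haC (by positivity)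
  have hR'a : R' ≤ aC := by rw [hR'd]; exact min_le_left _ _
  have hR'V : R' ≤ (1 - 4 * CG * C2T d α₀ * (εC + aC)) * RV := by rw [hR'd]; exact min_le_right _ _
  obtain ⟨C₄, hC₄d⟩ : ∃ C : ℝ, C = (Mρ * Cτ * ((2 * (1 / (1 - 4 * CG * C2T d α₀ * (εC + aC))) + 1) * ((ω ^ 3 * Ω) * (Mφ * BW * Mφ' * (d * latticeConst d δW))) * (C3Gen d L * (2 ^ d * (2 * d))) / aC) * (MJ * jfin)
            + (((ω ^ 3) * (Mφ * B₁W * Mφ' * (d * latticeConst d δ₁W)) * Ω) * C2T d α₀ * (1 / (1 - 4 * CG * C2T d α₀ * (εC + aC))) ^ 2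
                + Mρ * Cτ * (2 * ((ω ^ 3) * (Mφ * BW * Mφ' * (d * latticeConst d δW))) * (C3Gen d L * (2 ^ d * (2 * d))) * (1 / (1 - 4 * CG * C2T d α₀ * (εC + aC)))))
            + Mρ * Cτ * (2 * ((ω ^ 3 * Ω) * (Mφ * BW * Mφ' * (d * latticeConst d δW))) * (C3Gen d L * (2 ^ d * (2 * d))) * (1 / (1 - 4 * CG * C2T d α₀ * (εC + aC))))
                * (((ω ^ 3) * (Mφ * B₁W * Mφ' * (d * latticeConst d δ₁W)) * Ω) * C2T d α₀ * (1 / (1 - 4 * CG * C2T d α₀ * (εC + aC))) ^ 2) * R'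
            + Mρ * Cτ * (1 + (2 * ((ω ^ 3 * Ω) * (Mφ * BW * Mφ' * (d * latticeConst d δW))) * (C3Gen d L * (2 ^ d * (2 * d))) * (1 / (1 - 4 * CG * C2T d α₀ * (εC + aC)))) * R')
                * CV * (1 / (1 - 4 * CG * C2T d α₀ * (εC + aC))) ^ 2) := ⟨_, rfl⟩
  have hC₄ : 0 ≤ C₄ := by rw [hC₄d]; positivity
  have hcap20 : 0 < min (aC / 2) (min (R' / 6) (1 / (12 * CG * C₄ + 1))) := lt_min (by positivity) (lt_min (by positivity) (by positivity))
  obtain ⟨jr, ar, ε₄, hjr, har, hε₄, hcap2, hdom, hself, hcontr⟩ := exists_regime_scalars (B₀ := CG) (C₄ := C₄) (a₃ := R') hCG hC₄ hR'0 hcap20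
  have hsW0 : 0 < ε₄ + ar := by linarith only [hε₄, har]
  have hcap : ε₄ + ar ≤ aC := by linarith only [hcap2.trans (min_le_left _ _), haC]
  have hcapF : 2 * (ε₄ + ar) ≤ aC := by linarith only [hcap2.trans (min_le_left _ _)]
  have hdom6 : 6 * (ε₄ + ar) ≤ R' := by linarith only [hcap2.trans ((min_le_right _ _).trans (min_le_left _ _))]
  have hcontr12 : 12 * CG * C₄ * (ε₄ + ar) < 1 := by
    have h1 : ε₄ + ar ≤ 1 / (12 * CG * C₄ + 1) := hcap2.trans ((min_le_right _ _).trans (min_le_right _ _))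
    have h2 : (ε₄ + ar) * (12 * CG * C₄ + 1) ≤ 1 := by rwa [← le_div_iff₀ (by positivity)]
    nlinarith only [h2, hsW0, mul_nonneg hCG hC₄]
  obtain ⟨Rb, hRbd⟩ : ∃ R : ℝ, R = ar / (CG + 1) := ⟨_, rfl⟩
  have hRb : 0 < Rb := by rw [hRbd]; positivity
  obtain ⟨Rmap, hRmapd⟩ : ∃ R : ℝ, R = 1 / (1 - 4 * CG * C2T d α₀ * (εC + aC)) * (ε₄ + ar) := ⟨_, rfl⟩
  have hRmap0 : 0 < Rmap := by rw [hRmapd]; exact mul_pos (one_div_pos.2 h1q) hsW0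
  -- the modulus constant of the genuine slot at `(a_C, ε_C, R := ε₄ + a)`
  obtain ⟨KF, hKF0, HF⟩ := HF12 aC εC (ε₄ + ar) haC hεC.le hsW0 hcapF hCdom6 hεV (by linarith only [hCcontr12]) hqF
  -- the two denominators and the constant (the sibling's, with `δ_W ↦ K_F·(j₀ + α)`)
  obtain ⟨D₁, hD₁⟩ : ∃ D : ℝ, D = 1 - (0 + 4 * CG * C₄ * (2 * (ε₄ + ar) + (ε₄ + ar))) := ⟨_, rfl⟩
  obtain ⟨D₂, hD₂⟩ : ∃ D : ℝ, D = 1 - 4 * CG * C2T d α₀ * (2 * (εC + aC) + (εC + aC)) := ⟨_, rfl⟩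
  have hD₁0 : 0 < D₁ := by rw [hD₁]; linarith only [hcontr12]
  have hD₂0 : 0 < D₂ := by rw [hD₂]; linarith only [hCcontr12]
  obtain ⟨Pw, hPw⟩ : ∃ P : ℝ, P = ω * (Mφ * Mφ') * Ω := ⟨_, rfl⟩
  have hPw0 : 0 ≤ Pw := by rw [hPw]; positivity
  obtain ⟨⟨X1, hX1⟩, ⟨X4, hX4⟩, ⟨X5, hX5⟩⟩ : (∃ X : ℝ, X = Pw * (KG + KD) * (jr + C₄ * (ε₄ + ar) ^ 2)) ∧ (∃ X : ℝ, X = Pw * KA * Rb) ∧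
      (∃ X : ℝ, X = Pw * KA * (C2T d α₀ * (εC + aC) ^ 2)) := ⟨⟨_, rfl⟩, ⟨_, rfl⟩, ⟨_, rfl⟩⟩
  obtain ⟨hX10, hX40, hX50⟩ : 0 ≤ X1 ∧ 0 ≤ X4 ∧ 0 ≤ X5 := ⟨by rw [hX1]; positivity, by rw [hX4]; positivity, by rw [hX5]; positivity⟩
  obtain ⟨c1, hc1⟩ : ∃ c : ℝ, c = 1 / D₂ * ((X1 + X4) / D₁) + X5 / D₂ := ⟨_, rfl⟩
  obtain ⟨⟨c2, hc2⟩, ⟨c3, hc3⟩⟩ : (∃ c : ℝ, c = 1 / D₂ * (CG / D₁)) ∧ (∃ c : ℝ, c = CG / D₂) := ⟨⟨_, rfl⟩, ⟨_, rfl⟩⟩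
  obtain ⟨hc10, hc20, hc30⟩ : 0 ≤ c1 ∧ 0 ≤ c2 ∧ 0 ≤ c3 := ⟨by rw [hc1]; positivity, by rw [hc2]; positivity, by rw [hc3]; positivity⟩
  obtain ⟨cC, hcC⟩ : ∃ c : ℝ, c = 24 / r' * (εC + aC) := ⟨_, rfl⟩
  have hcC0 : 0 ≤ cC := by rw [hcC]; positivity
  obtain ⟨K, hK⟩ : ∃ K : ℝ, K = c1 + c3 * cC + c2 * KF + 1 := ⟨_, rfl⟩
  refine ⟨min (min (min αL αN) (min αW αF)) (min (min (α₀ / 2) (1 / (2 * ω * Ω + 1))) (r' / 6)), jfin, ε₄, εC, Rb, Rmap, K,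
    lt_min (lt_min (lt_min hαL0 hαN) (lt_min hαW hαF)) (lt_min (lt_min (by positivity) (by positivity)) (by positivity)), hjfin0, hε₄, hεC, hRb,
    hRmap0, by rw [hK]; positivity, ?_⟩
  intro n η _ hηL c₀ c₁ _ _ hw hρ' m _ hm U αU hα0 hα1 hαL hU1 hreg εU hεU hε1 hUε hLb α hα hαle' hUst hUb hUη hUw hpl hUgrad hRlev hεg hAQ hpos' hpos hc₀η j₀ hJ hj
    hposπ hQ hpos'₁ hpos₁ hQ1 hUG lev₀ levB lev₁ hlev hw₀ hw₁ hw₁' hw₃ hwB hw₁₂ h7E h7dX hUlev ρV hρn J₁ J₂ hJ₁ hJ₂ hqV hqV₁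
  obtain ⟨hαle1, hαle2⟩ := And.intro (hαle'.trans (min_le_left _ _)) (hαle'.trans (min_le_right _ _))
  obtain ⟨hαL', hαN', hαW', hαF'⟩ : α ≤ αL ∧ α ≤ αN ∧ α ≤ αW ∧ α ≤ αF :=
    ⟨hαle1.trans ((min_le_left _ _).trans (min_le_left _ _)), hαle1.trans ((min_le_left _ _).trans (min_le_right _ _)),
      hαle1.trans ((min_le_right _ _).trans (min_le_left _ _)), hαle1.trans ((min_le_right _ _).trans (min_le_right _ _))⟩
  obtain ⟨hαh, hαw, hαr'⟩ : α ≤ α₀ / 2 ∧ α ≤ 1 / (2 * ω * Ω + 1) ∧ α ≤ r' / 6 :=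
    ⟨hαle2.trans ((min_le_left _ _).trans (min_le_left _ _)), hαle2.trans ((min_le_left _ _).trans (min_le_right _ _)), hαle2.trans (min_le_right _ _)⟩
  obtain ⟨hjL', hjN', hjW', hjF'⟩ : j₀ ≤ jL ∧ j₀ ≤ jN ∧ j₀ ≤ jW ∧ j₀ ≤ jF := by
    rw [hjfin] at hj
    exact ⟨hj.trans ((min_le_left _ _).trans (min_le_left _ _)), hj.trans ((min_le_left _ _).trans (min_le_right _ _)),
      hj.trans ((min_le_right _ _).trans (min_le_left _ _)), hj.trans ((min_le_right _ _).trans (min_le_right _ _))⟩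
  -- `δ_C` PRODUCED: [B7] Prop. 7 at `k = n+1` levels read as a background modulus (`sectC_modulus_tower`) at `ρ′ := r′∕L^{n+1}`, `ρ := ρ∕L^{n+1}`, `ε := αη`
  have hK1 : (1 : ℝ) ≤ (L : ℝ) ^ (n + 1) := one_le_pow₀ (by exact_mod_cast hL)
  have hK0' : (0 : ℝ) < (L : ℝ) ^ (n + 1) := lt_of_lt_of_le one_pos hK1
  have hkr' : (L : ℝ) ^ (n + 1) * (r' / (L : ℝ) ^ (n + 1)) = r' := mul_div_cancel₀ _ hK0'.ne'
  have hkr : (L : ℝ) ^ (n + 1) * (ρ / (L : ℝ) ^ (n + 1)) = ρ := mul_div_cancel₀ _ hK0'.ne'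
  have hkε : (L : ℝ) ^ (n + 1) * (α * η) = α := by rw [mul_comm, mul_assoc, hηL, mul_one]
  have hη0' : 0 < η := Fact.out
  have hLη : (L : ℝ) ^ (n + 1) * η = 1 := by rw [mul_comm]; exact hηL
  have hαρ : 6 * (α * η) ≤ r' / (L : ℝ) ^ (n + 1) := by
    rw [le_div_iff₀ hK0', show 6 * (α * η) * (L : ℝ) ^ (n + 1) = 6 * α * ((L : ℝ) ^ (n + 1) * η) by ring, hLη, mul_one]; linarith only [hαr']
  have hδC := sectC_modulus_tower L m η (n + 1) U hL2 hG hα₀ hα3 hα8 (ρ' := r' / (L : ℝ) ^ (n + 1)) (ρ := ρ / (L : ℝ) ^ (n + 1)) (by positivity) (by positivity)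
    (by rw [hkr']; exact h7s') (by rw [hkr']; exact h7c') (by rw [hkr']; exact h7r'1) (by rw [hkr', hkr]; exact h7s) (by rw [hkr]; linarith only [h7c, hρ0])
    (ε := α * η) (by positivity) hUη hαρ lev₀ levB hlev lev₁ (εC := εC) (aC := aC) (by rw [hkr]; linarith only [hCdom6, hs0])
  rw [hkr', hkε] at hδC
  have hδC0 : 0 ≤ 24 / r' * α * (εC + aC) := by positivity
  have hx : 0 ≤ j₀ + α := add_nonneg ((norm_nonneg _).trans (hJ ⟨0, hd⟩ fun _ => 0)) hα
  have hη0 : 0 < η := Fact.out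
  -- (1) per lattice: (52) at `U` and at the vacuum from the plaquette window; `C_k`'s letters
  have hηinv : ((L : ℝ) ^ (n + 1))⁻¹ = η := inv_eq_of_mul_eq_one_left hηL
  have h52 : pdev (perCfg (towerP L m (n + 1)) U) < α₀ * (((L : ℝ) ^ (n + 1))⁻¹) ^ 2 := by
    have hp := pdev_perCfg_le_of_plaq (U := U) hUb (by positivity) hpl
    rw [hηinv]
    exact lt_of_le_of_lt hp (mul_lt_mul_of_pos_right (by linarith) (by positivity))
  have hUη1 : ∀ b' : Bond d (towerP L m (n + 1)), ‖(((fun _ : Bond d (towerP L m (n + 1)) => (1 : 𝔸ˣ)) b' : 𝔸ˣ) : 𝔸) - 1‖ ≤ 0 * η := fun _ => by simp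
  have hpl1 : ∀ p : B9SectCLatticeCarrier.Plaq d (towerP L m (n + 1)), ‖(plaqHolU (fun _ : Bond d (towerP L m (n + 1)) => (1 : 𝔸ˣ)) p : 𝔸) - 1‖ ≤ 0 * η ^ 2 :=
    fun p => by rw [plaqHolU_one, Units.val_one, sub_self, norm_zero, zero_mul]
  have hUgrad1 : ∀ (x : TSite d (towerP L m (n + 1))) (μ : Fin d), ‖(((fun _ : Bond d (towerP L m (n + 1)) => (1 : 𝔸ˣ)) (x, μ) : 𝔸ˣ) : 𝔸) - (fun _ : Bond d (towerP L m (n + 1)) => (1 : 𝔸ˣ)) (unshift μ x, μ)‖ ≤ 0 * η ^ 2 := fun x μ => by simp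
  have hJ1 := J_flat_le_zero L m n η (𝔸 := 𝔸)
  have hUb1 : ∀ b' : Bond d (towerP L m (n + 1)), (fun _ : Bond d (towerP L m (n + 1)) => (1 : 𝔸ˣ)) b' ∈ U1 𝔸 := fun _ => one_mem _
  have hUG1 : ∀ (x : B7Prop1Explicit.Site d) (κ : Fin d), perCfg (towerP L m (n + 1)) (fun _ : Bond d (towerP L m (n + 1)) => (1 : 𝔸ˣ)) x κ ∈ G :=
    fun x κ => by rw [B9Eq315QTorus.perCfg_apply]; exact G.one_mem
  have h52₁ : pdev (perCfg (towerP L m (n + 1)) (fun _ : Bond d (towerP L m (n + 1)) => (1 : 𝔸ˣ))) < α₀ * (((L : ℝ) ^ (n + 1))⁻¹) ^ 2 := by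
    have hp := pdev_perCfg_le_of_plaq (U := fun _ : Bond d (towerP L m (n + 1)) => (1 : 𝔸ˣ)) hUb1 (by positivity : (0 : ℝ) ≤ 0 * η ^ 2) hpl1
    rw [hηinv]
    exact lt_of_le_of_lt hp (mul_lt_mul_of_pos_right (by linarith) (by positivity))
  have hCk := quadAnalytic_Cck L m η (n + 1) U lev₀ lev₁ (nabla115 η U) levB hL2 hG hUG hα₀ hα3 hα4 h52 hlev hρ (by linarith only [hρ4, hρ0])
  have hCk1 := quadAnalytic_Cck L m η (n + 1) (fun _ : Bond d (towerP L m (n + 1)) => (1 : 𝔸ˣ)) lev₀ lev₁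
    (nabla115 η (fun _ : Bond d (towerP L m (n + 1)) => (1 : 𝔸ˣ))) levB hL2 hG hUG1 hα₀ hα3 hα4 h52₁ hlev hρ (by linarith only [hρ4, hρ0])
  -- the flat class data
  have hαL1 : ∀ j : ℕ, 50 * (d + 1) * (fun _ : ℕ => (0 : ℝ)) j * (L : ℝ) ^ d ≤ 1 / 2 := fun _ => by norm_num
  have hUε1 : ∀ (j : ℕ) (b' : Bond d (towerP L m (j + 1))), ‖(UlevOf L m (n + 1) (fun _ : Bond d (towerP L m (n + 1)) => (1 : 𝔸ˣ)) j b' : 𝔸) - 1‖ ≤ (fun _ : ℕ => (0 : ℝ)) j :=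
    fun j b' => by rw [UlevOf_one]; simp
  have hLb1 : ∀ (j : ℕ) (b' : Bond d (towerP L m (j + 1))), UlevOf L m (n + 1) (fun _ : Bond d (towerP L m (n + 1)) => (1 : 𝔸ˣ)) j b' ∈ U1 𝔸 := fun j b' => by
    rw [UlevOf_one]; exact one_mem _
  have hRlev1 : ∀ (j : ℕ) (b' : Bond d (towerP L m (j + 1))) (w : W), ‖adTransportW φ (UlevOf L m (n + 1) (fun _ : Bond d (towerP L m (n + 1)) => (1 : 𝔸ˣ)) j) b' w‖ ≤ ‖w‖ :=
    fun j b' w => by rw [UlevOf_one, B5Eq172HodgePositivity.adTransportW_one, LinearMap.id_apply]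
  have hUst1 : ∀ b' : Bond d (towerP L m (n + 1)), star ((fun _ : Bond d (towerP L m (n + 1)) => (1 : 𝔸ˣ)) b' : 𝔸) =
      ((((fun _ : Bond d (towerP L m (n + 1)) => (1 : 𝔸ˣ)) b')⁻¹ : 𝔸ˣ) : 𝔸) := fun _ => by simp
  have hεg1 : ∀ j < n + 1, (fun _ : ℕ => (0 : ℝ)) j ≤ 0 * ϱ ^ j := fun _ _ => by simp
  have hAQ1 : ∑ j ∈ Finset.range (n + 1), (fun _ : ℕ => (0 : ℝ)) j ≤ AQ := by simpa using (Finset.sum_nonneg fun j _ => hα0 j).trans hAQ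
  have hposπ₁ := (laplaceAkPi_one_pos_iff L m n φ τ η a' hpos'₁ hL (fun _ => 0) (fun _ => by norm_num)
    (perCfg_UlevOf_one_mem_U1 L m (n + 1)) (norm_Wcx_UlevOf_one_sub_one_le L m (n + 1) (fun _ => 0) (fun _ => le_rfl)) a (c₀ := c₀)).mpr hpos₁
  -- (2) the two operator norms at `U` and at the vacuum, against the ONE majorant `CG`
  obtain ⟨hGb, hHb⟩ := HN n η hηL c₀ c₁ hw hρ' m hm U αU hα0 hα1 hαL hU1 hreg εU hεU hUε hLb α hα hαN' hUst hUb hUη hpl hUgrad hRlev hεg hAQ hpos' hpos hc₀η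
    j₀ hJ hjN' hposπ hQ (L : ℝ) η lev₀ lev₁ levB
  obtain ⟨hGb1, hHb1⟩ := HN n η hηL c₀ c₁ hw hρ' m hm (fun _ : Bond d (towerP L m (n + 1)) => (1 : 𝔸ˣ)) (fun _ => 0) (fun _ => le_rfl) (fun _ => by norm_num) hαL1
    (perCfg_UlevOf_one_mem_U1 L m (n + 1)) (norm_Wcx_UlevOf_one_sub_one_le L m (n + 1) (fun _ => 0) (fun _ => le_rfl)) (fun _ => 0) (fun _ => le_rfl) hUε1 hLb1
    0 le_rfl hαN.le hUst1 hUb1 hUη1 hpl1 hUgrad1 hRlev1 hεg1 hAQ1 hpos'₁ hpos₁ hc₀η 0 hJ1 hjN.le hposπ₁ hQ1 (L : ℝ) η lev₀ lev₁ levB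
  rw [frakGLatticeCLM_laplaceAkPi_one L hL φ τ m n η hpos'₁ hpos₁ hposπ₁ hQ1 lev₀ lev₁] at hGb1
  rw [H1LatticeCLM_laplaceAkPi_one L hL φ τ m n η hpos'₁ hpos₁ hposπ₁ hQ1 lev₀ levB lev₁ (nabla115 η (fun _ : Bond d (towerP L m (n + 1)) => (1 : 𝔸ˣ)))] at hHb1
  have hMB : 0 ≤ Mφ * BN * Mφ' := by positivity
  have hmax : max ((NegSup.wSup (levWeight (L : ℝ) η lev₀ 1) : ℝ) * (Mφ * BN * Mφ')) (NegSup.wSup (levWeight (L : ℝ) η lev₁ 2) * (Mφ * BN * Mφ')) ≤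
      ω * (Mφ * BN * Mφ') :=
    max_le (mul_le_mul_of_nonneg_right hw₀ hMB) (mul_le_mul_of_nonneg_right hw₁ hMB)
  obtain ⟨hw3n, hwBn⟩ := And.intro (NegSup.wInvSup (levWeight (L : ℝ) η lev₀ 3)).coe_nonneg (NegSup.wInvSup (levWeight (L : ℝ) η levB 0)).coe_nonneg
  have hωB : 0 ≤ ω * (Mφ * BN * Mφ') := by positivity
  have hGb' := hGb.trans ((mul_le_mul hmax hw₃ hw3n hωB).trans (le_of_eq hCGd.symm))
  have hHb' := hHb.trans ((mul_le_mul hmax hwB hwBn hωB).trans (le_of_eq hCGd.symm))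
  have hGb1' := hGb1.trans ((mul_le_mul hmax hw₃ hw3n hωB).trans (le_of_eq hCGd.symm))
  have hHb1' := hHb1.trans ((mul_le_mul hmax hwB hwBn hωB).trans (le_of_eq hCGd.symm))
  -- (3) the Sect. C regimes at `U` and at the vacuum from the scalars; the W-slots' Prop. 4 (lattice-free composite constant) at `U` and at the vacuum (respelled); the chart regimes
  have hHpt : ∀ Bf : NegSize (L : ℝ) η levB 0 𝔸, ‖(H1LatticeCLM (L := (L : ℝ)) (η := η) (lev₀ := lev₀) (levB := levB) φ hposπ hQ lev₁ (nabla115 η U)) Bf‖ ≤ CG * ‖Bf‖ :=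
    fun Bf => (ContinuousLinearMap.le_opNorm _ Bf).trans (mul_le_mul_of_nonneg_right hHb' (norm_nonneg Bf))
  have hHpt1 : ∀ Bf : NegSize (L : ℝ) η levB 0 𝔸, ‖(H1LatticeCLM (L := (L : ℝ)) (η := η) (lev₀ := lev₀) (levB := levB) (c := ((η : ℂ))⁻¹)
        (R := adTransportW φ (fun _ : Bond d (towerP L m (n + 1)) => (1 : 𝔸ˣ)))
        (S := adTransportW φ fun _ : Bond d (towerP L m (n + 1)) => (1 : 𝔸ˣ)⁻¹) (Δ₁ := hessOp φ η (fun _ : Bond d (towerP L m (n + 1)) => (1 : 𝔸ˣ)) τ)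
        (Rr := RofUk L m n φ η (fun _ : Bond d (towerP L m (n + 1)) => (1 : 𝔸ˣ)))
        (Q := (QkW L m n φ (fun _ : Bond d (towerP L m (n + 1)) => (1 : 𝔸ˣ)) hL (fun _ => 0) (fun _ => by norm_num)
          (perCfg_UlevOf_one_mem_U1 L m (n + 1)) (norm_Wcx_UlevOf_one_sub_one_le L m (n + 1) (fun _ => 0) (fun _ => le_rfl)) (c₀ := c₀) (c₁ := c₁))) (a := a)
        φ hpos₁ hQ1 lev₁ (nabla115 η (fun _ : Bond d (towerP L m (n + 1)) => (1 : 𝔸ˣ)))) Bf‖ ≤ CG * ‖Bf‖ :=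
    fun Bf => (ContinuousLinearMap.le_opNorm _ Bf).trans (mul_le_mul_of_nonneg_right hHb1' (norm_nonneg Bf))
  have hGpt : ∀ f : NegSize (L : ℝ) η lev₀ 3 𝔸, ‖frakGLatticeCLM (L := (L : ℝ)) (η := η) (lev₀ := lev₀) φ hposπ hQ lev₁ (nabla115 η U) f‖ ≤ CG * ‖f‖ :=
    fun f => (ContinuousLinearMap.le_opNorm _ f).trans (mul_le_mul_of_nonneg_right hGb' (norm_nonneg f))
  have hGpt1 := fun f : NegSize (L : ℝ) η lev₀ 3 𝔸 => (ContinuousLinearMap.le_opNorm _ f).trans (mul_le_mul_of_nonneg_right hGb1' (norm_nonneg f))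
  have hCself' : CG * 0 + CG * C2T d α₀ * (εC + aC) ^ 2 ≤ εC := by have h0 : 0 ≤ CG * jT := mul_nonneg hCG hjT.le; linarith only [hCself, h0]
  have RC₁ : Regime (H1LatticeCLM (L := (L : ℝ)) (η := η) (lev₀ := lev₀) (levB := levB) φ hposπ hQ lev₁ (nabla115 η U)) 0 (Cck L m η (n + 1) U lev₀ lev₁ (nabla115 η U) levB) CG 0 (C2T d α₀) ρ 0 aC εC :=
    Regime.of_normBound_zeroLinear _ hCG hHpt hCk hC2T hεC.le hCdom hCself' hCcontr
  have RC₂ : Regime (H1LatticeCLM (L := (L : ℝ)) (η := η) (lev₀ := lev₀) (levB := levB) (c := ((η : ℂ))⁻¹)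
        (R := adTransportW φ (fun _ : Bond d (towerP L m (n + 1)) => (1 : 𝔸ˣ)))
        (S := adTransportW φ fun _ : Bond d (towerP L m (n + 1)) => (1 : 𝔸ˣ)⁻¹) (Δ₁ := hessOp φ η (fun _ : Bond d (towerP L m (n + 1)) => (1 : 𝔸ˣ)) τ)
        (Rr := RofUk L m n φ η (fun _ : Bond d (towerP L m (n + 1)) => (1 : 𝔸ˣ)))
        (Q := (QkW L m n φ (fun _ : Bond d (towerP L m (n + 1)) => (1 : 𝔸ˣ)) hL (fun _ => 0) (fun _ => by norm_num)
          (perCfg_UlevOf_one_mem_U1 L m (n + 1)) (norm_Wcx_UlevOf_one_sub_one_le L m (n + 1) (fun _ => 0) (fun _ => le_rfl)) (c₀ := c₀) (c₁ := c₁))) (a := a)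
        φ hpos₁ hQ1 lev₁ (nabla115 η (fun _ : Bond d (towerP L m (n + 1)) => (1 : 𝔸ˣ)))) 0
      (Cck L m η (n + 1) (fun _ : Bond d (towerP L m (n + 1)) => (1 : 𝔸ˣ)) lev₀ lev₁ (nabla115 η (fun _ : Bond d (towerP L m (n + 1)) => (1 : 𝔸ˣ))) levB) CG 0 (C2T d α₀) ρ 0 aC εC :=
    Regime.of_normBound_zeroLinear _ hCG hHpt1 hCk1 hC2T hεC.le hCdom hCself' hCcontr
  have RC₂π : Regime (H1LatticeCLM (L := (L : ℝ)) (η := η) (lev₀ := lev₀) (levB := levB) φ hposπ₁ hQ1 lev₁ (nabla115 η (fun _ : Bond d (towerP L m (n + 1)) => (1 : 𝔸ˣ)))) 0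
      (Cck L m η (n + 1) (fun _ : Bond d (towerP L m (n + 1)) => (1 : 𝔸ˣ)) lev₀ lev₁ (nabla115 η (fun _ : Bond d (towerP L m (n + 1)) => (1 : 𝔸ˣ))) levB) CG 0 (C2T d α₀) ρ 0 aC εC := by
    rw [H1LatticeCLM_laplaceAkPi_one L hL φ τ m n η hpos'₁ hpos₁ hposπ₁ hQ1 lev₀ levB lev₁ (nabla115 η (fun _ : Bond d (towerP L m (n + 1)) => (1 : 𝔸ˣ)))]; exact RC₂
  -- the weight ratios and profile letters of the kernel route (`ϖ = ω³Ω`, `ϖ′ = ω³`, `w̄₃ ≤ ω³`)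
  have hL1 : (1 : ℝ) ≤ (L : ℝ) := by exact_mod_cast hL
  have hwb : ∀ b' : Bond d (towerP L m (n + 1)), levWeight (L : ℝ) η lev₀ 1 b' ≤ ω := fun b' =>
    (NegSup.le_wSup (w := levWeight (L : ℝ) η lev₀ 1) b').trans hw₀
  have hw3p : ∀ b' : Bond d (towerP L m (n + 1)), 0 < levWeight (L : ℝ) η lev₀ 3 b' := levWeight_pos (Fact.out : 0 < (L : ℝ)) hη0 lev₀ 3
  have hw1ge : ∀ b' : Bond d (towerP L m (n + 1)), 1 ≤ levWeight (L : ℝ) η lev₀ 1 b' := fun b' => by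
    rw [levWeight_apply, pow_one]
    calc (1 : ℝ) = (L : ℝ) ^ (n + 1) * η := hLη.symm
      _ ≤ (L : ℝ) ^ lev₀ b' * η := mul_le_mul_of_nonneg_right (pow_le_pow_right₀ hL1 (hlev b')) hη0.le
  have hratio : ∀ bb b' : Bond d (towerP L m (n + 1)), levWeight (L : ℝ) η lev₀ 3 bb / levWeight (L : ℝ) η lev₀ 3 b' ≤ ω ^ 3 * Ω := by
    intro bb b'
    have hnum : levWeight (L : ℝ) η lev₀ 3 bb ≤ ω ^ 3 := B11Eq28JcurWindow.levWeight_three_le (L : ℝ) hwb bb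
    have hden : (levWeight (L : ℝ) η lev₀ 3 b')⁻¹ ≤ Ω := (NegSup.inv_le_wInvSup (w := levWeight (L : ℝ) η lev₀ 3) b').trans hw₃
    rw [div_eq_mul_inv]
    exact mul_le_mul hnum hden (inv_nonneg.2 (hw3p b').le) (by positivity)
  have hratio' : ∀ bb b' : Bond d (towerP L m (n + 1)), levWeight (L : ℝ) η lev₀ 3 bb / levWeight (L : ℝ) η lev₀ 1 b' ≤ ω ^ 3 := by
    intro bb b'
    have hnum : levWeight (L : ℝ) η lev₀ 3 bb ≤ ω ^ 3 := B11Eq28JcurWindow.levWeight_three_le (L : ℝ) hwb bb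
    exact (div_le_self (hw3p bb).le (hw1ge b')).trans hnum
  have hω₃ : (NegSup.wSup (levWeight (L : ℝ) η lev₀ 3) : ℝ) ≤ ω ^ 3 := by
    have hω3 : 0 ≤ ω ^ 3 := by positivity
    have h : NegSup.wSup (levWeight (L : ℝ) η lev₀ 3) ≤ ⟨ω ^ 3, hω3⟩ := Finset.sup_le fun b' _ => by
      rw [← NNReal.coe_le_coe, NegSup.coe_wNN (w := levWeight (L : ℝ) η lev₀ 3)]
      exact B11Eq28JcurWindow.levWeight_three_le (L : ℝ) hwb b'
    exact NNReal.coe_le_coe.2 h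
  have hUlev1 : ∀ (j : ℕ) (bb : Bond d (towerP L m (j + 1))), star (UlevOf L m (n + 1) (fun _ : Bond d (towerP L m (n + 1)) => (1 : 𝔸ˣ)) j bb : 𝔸) = ((UlevOf L m (n + 1) (fun _ : Bond d (towerP L m (n + 1)) => (1 : 𝔸ˣ)) j bb)⁻¹ : 𝔸ˣ) :=
    fun j bb => by rw [UlevOf_one]; simp
  have hJ₁' : ‖J₁‖ ≤ MJ * jfin := hJ₁.trans (mul_le_mul_of_nonneg_left hj hMJ)
  have hJ₂' : ‖J₂‖ ≤ MJ * jfin := hJ₂.trans (mul_le_mul_of_nonneg_left hj hMJ)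
  -- the W-slot's Prop. 4 at `U` and at the vacuum, at the composite constant `C₄ᶜ =: C₄` and radius `R′`
  obtain ⟨hq98, -⟩ := HW n η hηL c₀ c₁ hw hρ' m hm U αU hα0 hα1 hαL hU1 hreg εU hεU hUε hLb α hα hαW' hUst hUb hUη hpl hUgrad hRlev hεg hAQ hpos' hpos hc₀η
    j₀ hJ hjW' hposπ hQ lev₀ lev₁ (nabla115 η U) levB hL2 hG hUG hα₀ hα3 hα4 h52 hlev hρ hρ4 hθ hC3 RC₁ haC (by linarith only [hCdom6, hs0]) (by positivity) hratio
    (by positivity) hratio' hqW hUlev hCV hRV hMρ (by positivity : 0 ≤ MJ * jfin) hω₃ hwB hR'0 hR'a hR'V ρV U hρn hqV J₁ hJ₁'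
  obtain ⟨hq98₁, -⟩ := HW n η hηL c₀ c₁ hw hρ' m hm (fun _ : Bond d (towerP L m (n + 1)) => (1 : 𝔸ˣ)) (fun _ => 0) (fun _ => le_rfl) (fun _ => by norm_num) hαL1
    (perCfg_UlevOf_one_mem_U1 L m (n + 1)) (norm_Wcx_UlevOf_one_sub_one_le L m (n + 1) (fun _ => 0) (fun _ => le_rfl)) (fun _ => 0) (fun _ => le_rfl) hUε1 hLb1
    0 le_rfl hαW.le hUst1 hUb1 hUη1 hpl1 hUgrad1 hRlev1 hεg1 hAQ1 hpos'₁ hpos₁ hc₀η 0 hJ1 hjW.le hposπ₁ hQ1 lev₀ lev₁ (nabla115 η (fun _ : Bond d (towerP L m (n + 1)) => (1 : 𝔸ˣ))) levB hL2 hG hUG1 hα₀ hα3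
    hα4 h52₁ hlev hρ hρ4 hθ hC3 RC₂π haC (by linarith only [hCdom6, hs0]) (by positivity) hratio (by positivity) hratio' hqW hUlev1 hCV hRV hMρ
    (by positivity : 0 ≤ MJ * jfin) hω₃ hwB hR'0 hR'a hR'V ρV (fun _ : Bond d (towerP L m (n + 1)) => (1 : 𝔸ˣ)) hρn hqV₁ J₂ hJ₂'
  rw [H1LatticeCLM_laplaceAkPi_one L hL φ τ m n η hpos'₁ hpos₁ hposπ₁ hQ1 lev₀ levB lev₁ (nabla115 η (fun _ : Bond d (towerP L m (n + 1)) => (1 : 𝔸ˣ)))] at hq98₁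
  rw [laplaceAkPi_one_eq_laplaceAk_one] at hq98₁
  rw [← hC₄d] at hq98 hq98₁
  have R₁ := Regime.of_normBound_zeroLinear _ hCG hGpt hq98 hC₄ hε₄.le hdom hself hcontr
  have R₂ := Regime.of_normBound_zeroLinear _ hCG hGpt1 hq98₁ hC₄ hε₄.le hdom hself hcontr
  have hBU : ∀ B ∈ ball (0 : NegSize (L : ℝ) η levB 0 𝔸) Rb, ‖(H1LatticeCLM (L := (L : ℝ)) (η := η) (lev₀ := lev₀) (levB := levB) φ hposπ hQ lev₁ (nabla115 η U)) B‖ < ar := fun B hBb => by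
    rw [mem_ball_zero_iff] at hBb
    calc _ ≤ CG * ‖B‖ := hHpt B
      _ ≤ CG * Rb := mul_le_mul_of_nonneg_left hBb.le hCG
      _ = ar * (CG / (CG + 1)) := by rw [hRbd]; ring
      _ < ar := mul_lt_of_lt_one_right har ((div_lt_one (by positivity)).2 (by linarith only [hCG]))
  have hB1 : ∀ B ∈ ball (0 : NegSize (L : ℝ) η levB 0 𝔸) Rb, ‖(H1LatticeCLM (L := (L : ℝ)) (η := η) (lev₀ := lev₀) (levB := levB) (c := ((η : ℂ))⁻¹)
        (R := adTransportW φ (fun _ : Bond d (towerP L m (n + 1)) => (1 : 𝔸ˣ)))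
        (S := adTransportW φ fun _ : Bond d (towerP L m (n + 1)) => (1 : 𝔸ˣ)⁻¹) (Δ₁ := hessOp φ η (fun _ : Bond d (towerP L m (n + 1)) => (1 : 𝔸ˣ)) τ)
        (Rr := RofUk L m n φ η (fun _ : Bond d (towerP L m (n + 1)) => (1 : 𝔸ˣ)))
        (Q := (QkW L m n φ (fun _ : Bond d (towerP L m (n + 1)) => (1 : 𝔸ˣ)) hL (fun _ => 0) (fun _ => by norm_num)
          (perCfg_UlevOf_one_mem_U1 L m (n + 1)) (norm_Wcx_UlevOf_one_sub_one_le L m (n + 1) (fun _ => 0) (fun _ => le_rfl)) (c₀ := c₀) (c₁ := c₁))) (a := a)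
        φ hpos₁ hQ1 lev₁ (nabla115 η (fun _ : Bond d (towerP L m (n + 1)) => (1 : 𝔸ˣ)))) B‖ < ar := fun B hBb => by
    rw [mem_ball_zero_iff] at hBb
    calc _ ≤ CG * ‖B‖ := hHpt1 B
      _ ≤ CG * Rb := mul_le_mul_of_nonneg_left hBb.le hCG
      _ = ar * (CG / (CG + 1)) := by rw [hRbd]; ring
      _ < ar := mul_lt_of_lt_one_right har ((div_lt_one (by positivity)).2 (by linarith only [hCG]))
  -- THE PACKAGE: the four regimes, the radii bookkeeping, the fibre-map bounds — then the Lipschitz member for `‖B‖ < R_b`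
  refine ⟨CG, C₄, R', jr, ar, aC, hjr.le, har, hcap, hR'a, le_of_eq hRmapd.symm, R₁, R₂, RC₁, RC₂, hBU, hB1, fun B hBb => ?_⟩
  have hBU' := hBU B (mem_ball_zero_iff.2 hBb)
  have hB1' := hB1 B (mem_ball_zero_iff.2 hBb)
  -- the jet identity's letter `K_ι = 1 + w̄₁·2α·w̲₁⁻¹ ≤ 2`
  have hKι : 1 + (NegSup.wSup (levWeight (L : ℝ) η lev₁ 2) : ℝ) * (2 * α) * NegSup.wInvSup (levWeight (L : ℝ) η lev₀ 1) ≤ 2 := by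
    have h1 : (NegSup.wSup (levWeight (L : ℝ) η lev₁ 2) : ℝ) * (2 * α) * NegSup.wInvSup (levWeight (L : ℝ) η lev₀ 1) ≤ ω * (2 * α) * Ω :=
      mul_le_mul (mul_le_mul_of_nonneg_right hw₁ (by positivity)) hw₁' (NegSup.wInvSup (levWeight (L : ℝ) η lev₀ 1)).coe_nonneg (by positivity)
    have h2 : α * (2 * ω * Ω + 1) ≤ 1 := by rw [← le_div_iff₀ (by positivity)]; exact hαw
    linarith only [h1, h2, hα]
  -- (4) THE CHART-LEVEL COMPOSITION with every scalar letter produced and `δ_W := K_F·(j₀ + α)` SUPPLIED by the Lit assembly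
  have hmain := HLip n η hηL c₀ c₁ hw hρ' m hm U αU hα0 hα1 hαL hU1 hreg εU hεU hε1 hUε hLb α hα hαL' hUst hUb hUη hUw hpl hUgrad hRlev hεg hAQ hpos' hpos
    hc₀η j₀ hJ hjL' hposπ hQ hpos'₁ hpos₁ hQ1 lev₀ levB lev₁ R₁ R₂ hjr.le hjr.le B hBU' hB1'
    (fun P hP => HF n η hηL c₀ c₁ hw hρ' m hm U αU hα0 hα1 hαL hU1 hreg εU hεU hε1 hUε hLb α hα hαF' hUst hUb hUη hUw hpl hUgrad hRlev hεg hAQ hpos' hpos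
      hc₀η j₀ hJ hjF' hposπ hQ hpos'₁ hpos₁ hQ1 lev₀ levB lev₁ hlev hUG h52 h7E h7dX RC₁ RC₂ hratio hratio' hw₀ hw₁ hw₁' hw₁₂ hω₃ hwB hUlev ρV hρn J₁ J₂ hJ₁ hJ₂
      hqV hqV₁ P hP)
    (show (1 + (NegSup.wSup (levWeight (L : ℝ) η lev₁ 2) : ℝ) * (2 * α) * NegSup.wInvSup (levWeight (L : ℝ) η lev₀ 1)) * (ε₄ + ar) ≤ 2 * (ε₄ + ar) from
      mul_le_mul_of_nonneg_right hKι hsW0.le)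
    (show ε₄ + ar ≤ 2 * (ε₄ + ar) by linarith only [hsW0]) hsW0 (show 2 * (2 * (ε₄ + ar) + (ε₄ + ar)) ≤ R' by linarith only [hdom6])
    (show 0 + 4 * CG * C₄ * (2 * (ε₄ + ar) + (ε₄ + ar)) < 1 by linarith only [hcontr12]) RC₁ RC₂ hcap hcap hδC
    (show (1 + (NegSup.wSup (levWeight (L : ℝ) η lev₁ 2) : ℝ) * (2 * α) * NegSup.wInvSup (levWeight (L : ℝ) η lev₀ 1)) * (εC + aC) ≤ 2 * (εC + aC) from
      mul_le_mul_of_nonneg_right hKι hs0.le)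
    (show εC + aC ≤ 2 * (εC + aC) by linarith only [hs0]) hs0 (show 2 * (2 * (εC + aC) + (εC + aC)) ≤ ρ by linarith only [hCdom6])
    (show 4 * CG * C2T d α₀ * (2 * (εC + aC) + (εC + aC)) < 1 by linarith only [hCcontr12])
  rw [← hD₁, ← hD₂] at hmain
  refine hmain.trans ?_
  -- (5) the constants
  obtain ⟨hw0n, hw1n⟩ := And.intro (NegSup.wSup (levWeight (L : ℝ) η lev₀ 1)).coe_nonneg (NegSup.wSup (levWeight (L : ℝ) η lev₁ 2)).coe_nonneg
  have hMle : ∀ {X Y : ℝ}, 0 ≤ X → X ≤ Y → ∀ {v : ℝ}, 0 ≤ v → v ≤ Ω →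
      max ((NegSup.wSup (levWeight (L : ℝ) η lev₀ 1) : ℝ) * (Mφ * ((j₀ + α) * X) * Mφ')) (NegSup.wSup (levWeight (L : ℝ) η lev₁ 2) * (Mφ * ((j₀ + α) * X) * Mφ')) * v ≤
        (j₀ + α) * (Pw * Y) := by
    intro X Y hX0 hXY v hv0 hvΩ
    have h1 : Mφ * ((j₀ + α) * X) * Mφ' ≤ Mφ * ((j₀ + α) * Y) * Mφ' := mul_le_mul_of_nonneg_right (mul_le_mul_of_nonneg_left (mul_le_mul_of_nonneg_left hXY hx) hMφ) hMφ'
    have h0 : 0 ≤ Mφ * ((j₀ + α) * Y) * Mφ' := by have := hX0.trans hXY; positivity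
    have hM : max ((NegSup.wSup (levWeight (L : ℝ) η lev₀ 1) : ℝ) * (Mφ * ((j₀ + α) * X) * Mφ')) (NegSup.wSup (levWeight (L : ℝ) η lev₁ 2) * (Mφ * ((j₀ + α) * X) * Mφ')) ≤
        ω * (Mφ * ((j₀ + α) * Y) * Mφ') :=
      max_le ((mul_le_mul_of_nonneg_left h1 hw0n).trans (mul_le_mul_of_nonneg_right hw₀ h0)) ((mul_le_mul_of_nonneg_left h1 hw1n).trans (mul_le_mul_of_nonneg_right hw₁ h0))
    calc _ ≤ ω * (Mφ * ((j₀ + α) * Y) * Mφ') * Ω := mul_le_mul hM hvΩ hv0 (mul_nonneg hω h0)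
      _ = (j₀ + α) * (Pw * Y) := by rw [hPw]; ring
  have ht1 := hMle hKG (show KG ≤ KG + KD by linarith) hw3n hw₃
  have ht1' := hMle hKD (show KD ≤ KG + KD by linarith) hw3n hw₃
  have ht2 := hMle hKA le_rfl hwBn hwB
  have hmaxGD : max ((NegSup.wSup (levWeight (L : ℝ) η lev₀ 1) : ℝ) * (Mφ * ((j₀ + α) * KG) * Mφ')) (NegSup.wSup (levWeight (L : ℝ) η lev₁ 2) * (Mφ * ((j₀ + α) * KD) * Mφ')) *
      NegSup.wInvSup (levWeight (L : ℝ) η lev₀ 3) ≤ (j₀ + α) * (Pw * (KG + KD)) := by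
    rcases le_total ((NegSup.wSup (levWeight (L : ℝ) η lev₀ 1) : ℝ) * (Mφ * ((j₀ + α) * KG) * Mφ')) (NegSup.wSup (levWeight (L : ℝ) η lev₁ 2) * (Mφ * ((j₀ + α) * KD) * Mφ')) with h | h
    · rw [max_eq_right h]; exact (mul_le_mul_of_nonneg_right (le_max_right _ _) hw3n).trans ht1'
    · rw [max_eq_left h]; exact (mul_le_mul_of_nonneg_right (le_max_left _ _) hw3n).trans ht1
  have hnum1 : max ((NegSup.wSup (levWeight (L : ℝ) η lev₀ 1) : ℝ) * (Mφ * ((j₀ + α) * KG) * Mφ')) (NegSup.wSup (levWeight (L : ℝ) η lev₁ 2) * (Mφ * ((j₀ + α) * KD) * Mφ')) *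
        NegSup.wInvSup (levWeight (L : ℝ) η lev₀ 3) * (jr + C₄ * (ε₄ + ar) ^ 2) + 0 * (ε₄ + ar) + CG * (KF * (j₀ + α)) +
      max ((NegSup.wSup (levWeight (L : ℝ) η lev₀ 1) : ℝ) * (Mφ * ((j₀ + α) * KA) * Mφ')) (NegSup.wSup (levWeight (L : ℝ) η lev₁ 2) * (Mφ * ((j₀ + α) * KA) * Mφ')) *
        NegSup.wInvSup (levWeight (L : ℝ) η levB 0) * ‖B‖ ≤ (j₀ + α) * (X1 + X4) + CG * (KF * (j₀ + α)) := by
    have h1 := mul_le_mul_of_nonneg_right hmaxGD (show 0 ≤ jr + C₄ * (ε₄ + ar) ^ 2 by positivity)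
    have h2 := mul_le_mul ht2 hBb.le (norm_nonneg B) (by positivity)
    rw [hX1, hX4]; linarith [h1, h2]
  have hnum2 : max ((NegSup.wSup (levWeight (L : ℝ) η lev₀ 1) : ℝ) * (Mφ * ((j₀ + α) * KA) * Mφ')) (NegSup.wSup (levWeight (L : ℝ) η lev₁ 2) * (Mφ * ((j₀ + α) * KA) * Mφ')) *
        NegSup.wInvSup (levWeight (L : ℝ) η levB 0) * (C2T d α₀ * (εC + aC) ^ 2) + CG * (24 / r' * α * (εC + aC)) ≤
      (j₀ + α) * X5 + CG * (24 / r' * α * (εC + aC)) := by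
    have h1 := mul_le_mul_of_nonneg_right ht2 (show 0 ≤ C2T d α₀ * (εC + aC) ^ 2 by positivity)
    rw [hX5]; linarith [h1]
  have hiD₂ : 0 ≤ 1 / D₂ := div_nonneg zero_le_one hD₂0.le
  refine (add_le_add (mul_le_mul_of_nonneg_left (div_le_div_of_nonneg_right hnum1 hD₁0.le) hiD₂) (div_le_div_of_nonneg_right hnum2 hD₂0.le)).trans ?_
  have e : 1 / D₂ * (((j₀ + α) * (X1 + X4) + CG * (KF * (j₀ + α))) / D₁) + ((j₀ + α) * X5 + CG * (24 / r' * α * (εC + aC))) / D₂ =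
      (j₀ + α) * c1 + (KF * (j₀ + α)) * c2 + α * (c3 * cC) := by
    rw [hc1, hc2, hc3, hcC]; field_simp; ring
  rw [e, hK]
  have hj₀0 : 0 ≤ j₀ := (norm_nonneg _).trans (hJ ⟨0, hd⟩ fun _ => 0)
  nlinarith only [hx, hj₀0, hc30, hcC0, hc10, hc20, hKF0, mul_nonneg hj₀0 (mul_nonneg hc30 hcC0)]

end Literature.MathematicalPhysics.QuantumFieldTheory.Balaban1983to89.B11Eq174ChartRegimesLipschitzAtFlatW80LatticeFree

end
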